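import Mathlib
import HarnessLib
import Literature.MathematicalPhysics.StatisticalMechanics.MuGSC
import Literature.MathematicalPhysics.StatisticalMechanics.LennardJonesClusters
import Literature.Geometry.DiscreteGeometry.KissingPatterns
import Summits.AtomisticToContinuum.Statement
import Summits.AtomisticToContinuum.Crystallization.Theses.OverbindingBudget
import Summits.AtomisticToContinuum.Crystallization.Theorems.OverbindingBudgetCubeChargeLaw
import Summits.AtomisticToContinuum.Crystallization.Theorems.OverbindingBudgetExcessInstability
import Summits.AtomisticToContinuum.Crystallization.Theorems.OverbindingBudgetViolatorDensityFloor
import Summits.AtomisticToContinuum.Crystallization.Theorems.OverbindingBudgetWallTensionLever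
import Summits.AtomisticToContinuum.Crystallization.Theorems.OverbindingBudgetPatchTransport

/-!
# OverbindingBudget — the CLEANLESS CUT of the declared residual `UnhostedResidual 10` (helper, `--supports stmt-31280`)

Route `OverbindingBudget` (Crystallization), crux `RobustDefectLimitWindows` (stmt-AtomisticToContinuum-31280), registered skeleton line v7
«HostedDustCut» (sha 624a0fa0…), whose sixth stub `stub_unhostedResidual` is the DECLARED RESIDUAL `UnhostedResidual 10`: RDEF's hypotheses ∧
«no host» (at every admissible spacing `a ∈ [47/50, 1]` the texture is TORN — some exactly clean site is not 1/5-Barlow-close — or THICK —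
some ball of radius 10 contains no exactly clean Barlow site) ⟹ windows.  This file (decomp-a2c lens 4 «minimal counterexample / extremal
reduction», generation 17) lands, complete (no placeholders) and over LANDED Theorems files only, the next NORMAL FORM of the minimal
counterexample and the law that empties one side of it.  Nothing here is registered on the line (cell critic waiver (w2), CRITIC-LEDGER
row 134): the registered residual is DERIVED (K7), never re-typed; the texts below are what a later bundle may register.

* §A  `Hosted r₀`, `UnhostedResidual r₀` (verbatim generation 14, now over the tree's `MAT` / `ThinCores`; pin `unhostedResidual_ten_iff`:
  at `r₀ = 10` it is LITERALLY the registered stub text, `Iff.rfl`), `HostedTarget r₀`; the CUT LITERAL `CleanBearing Y` := at some admissible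
  spacing some site of `Y` is t-ROBUSTLY clean Barlow for some `t > 0` (`CleanT a t`, the lineage's gen-11 predicate, landed in
  `…WallTensionLever`); the two pieces `CleanlessPiece r₀` (RDEF-hyps ∧ ¬Hosted ∧ ¬CleanBearing ⟹ windows) and `CleanBearingResidual r₀`
  (RDEF-hyps ∧ ¬Hosted ∧ CleanBearing ⟹ windows); `BareOn Y K` (no site of `Y` in the body `K` is robustly clean at any admissible spacing)
  and the LAW `CleanlessExcess`.
* §B  kernels (complete, no placeholders): **K1 `unhostedResidual_iff_pieces`** (the cut is exact: excluded middle on `CleanBearing Y`);  K2 `cleanT_clean`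
  (robustly clean ⟹ exactly clean Barlow, gen-11 kernel re-landed); **K3 `thinCores_of_cleanT_recurrent` — THE MINIMALITY NORMAL FORM**: in a
  uniformly discrete two-way uniformly recurrent texture of covering radius `< 9/10`, ONE t-robustly clean Barlow site at spacing `a` forces
  (t/2)-robustly clean Barlow sites within bounded distance of EVERY site, hence `ThinCores a r Y` for some finite `r` (landed
  `cleanT_transport` + recurrence: «the minimal counterexample is either Barlow-free at every admissible spacing or Barlow-syndetic at one»);
  K4 `cubeFloor_of_cleanlessExcess`; **K5 `cleanlessPiece_of_cleanlessExcess : CleanlessExcess → CleanlessPiece r₀`** (the door side is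
  VACUOUS given the law: a Barlow-free texture is bare on every cube, the law gives the per-particle floor on all cubes, the landed transfer
  lemma `cubeCharge_of_cubeFloor` (WallTensionLever K3a) gives site charge `> (κ/16)ℓ³` on every large even cube, the landed `cubeChargeLaw`
  (stmt-30251) gives `|charge| ≤ (κ/16)ℓ³` — contradiction; RDEF's μ-stability is the only hypothesis consumed);  K6 composition
  `unhostedResidual_of_law_residual : CleanlessExcess → CleanBearingResidual r₀ → UnhostedResidual r₀`;  K7 `rdef_iff_hosted_unhosted`,
  `rdef_iff_three` (RDEF BY NAME ⟺ HostedTarget ∧ CleanlessPiece ∧ CleanBearingResidual);  K8 sanity `…_of_rdef` (each piece is a restriction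
  of RDEF — never stronger than the item);  K9 `finiteDepth_of_cleanBearing` (the residual world at its clean-bearing spacing: clean Barlow sites
  r-dense for some finite r, yet torn there or thicker than 10 somewhere).
* §E  pins (`Iff.rfl`): `unhostedResidual_ten_iff` (↔ the registered stub text), `cleanlessPiece_ten_iff`, `cleanBearingResidual_ten_iff`,
  `cleanlessExcess_iff` — fully expanded over Mathlib + Literature declarations (the texts a future registration uses).

THE LAW · `CleanlessExcess` (GS-free, x-free, μGSC-free, recurrence-free, MAT-free, core-free; shape of the landed lever `WallTension`): for every
coexistence level `e` (TEND ∧ LB) and separation `δ > 0` there are `κ > 0`, `σ ≥ 0` such that for every `δ`-separated `Y ⊆ ℝ³`, every centre `c`,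
radius `R ≥ 1` and CONVEX body `K` with `B̄(c,R/4) ⊆ K ⊆ B̄(c,R)`: if NO site of `Y ∩ K` is robustly clean Barlow at ANY admissible spacing
(`BareOn Y K`), the internal energy of the chunk `S = Y ∩ K` obeys `(e + κ)·#S − σR² ≤ ½ΣΣ_{S} V`.  At `κ = 0, σ = 0` this is TRUE by LB alone
(`½ΣΣ_S V ≥ E(#S) ≥ e·#S`); the content is the UNIFORM MARGIN κ: Barlow-free bulk — polytetrahedral / Frank–Kasper / icosahedral order, bcc-,
sc-, diamond-type packings, amorphous packings, and Barlow crystals strained or modulated past the 1/50 window everywhere — cannot approach the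
coexistence energy per particle.  WHY IT SHOULD HOLD (mechanism; census numbers uncertified): the twelve-neighbour LJ energy landscape has its
bulk minimum at the Barlow stackings (lattice-sum margin of hcp/fcc over every other known periodic competitor ≥ 1.5e-2 per particle: bcc +3.7e-1ε
per particle classical, A15/σ/C15 tcp +1–3 %, icosahedral glass +2–4 % (cell census structure zoo, I-B8-lite; uncertified)); a site failing the robust 1/50-window at EVERY
admissible spacing has a 12-shell spread ≥ 4 % or a scale outside [0.92, 1.02] or a coordination ≠ 12 inside 1.26a or a shell 1/5-far from both
kissing patterns, each costing ≥ c·(1/50)² ≈ 2.5e-3 per site by the curvature `V''(1) = 6` of the pair potential at its minimum (the cheapest: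
one bond per site stretched 4 %); convexity caps the body's missing external binding by `σR²`.  WHY IT MIGHT FAIL (kill criterion, census ask
I-B17): a family of robustly-Barlow-free finite chunks whose internal energy per particle tends to `e` — e.g. ever more dilute «de-cleaning»
modulations of hcp whose cost per site → 0 while every site still fails the window at every `a` (the estimate above says the cost floor is
≈ 2.5e-3, not 0: the window failure is a HARD constraint per site), or an unknown non-Barlow packing degenerate with hcp/fcc for LJ (contradicts
every lattice-sum census; it would also refute `Crystallization` (i)'s attained minimum being Barlow, which the summit does not claim but every
line of the cell uses).  TAGS (cell doctrine): `CleanlessExcess` XL · IDEA-NEEDED (a quantitative crystallization inequality AWAY from the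
minimiser set — uniform energy gap of Barlow-free bulk; no far field, no interface) · INSTRUMENTABLE (finite patches: per (e, δ, R) a finite-
dimensional variational inequality; census ask I-B17 = the datum κ_bare) · EXPECTED TRUE-type on the census zoo (no datum yet: I-B17) · BARRIER-adjacent: it is the typed form of the
«geometric frustration costs energy» heuristic (`TetrahedralFrustration`, `IcosahedralClusters`, `SutoDegenerateGroundStates` name exactly the
competitors it prices) — honest: the law RELOCATES the frustration core of the residual into one clean GS-free inequality, it does not dissolve it.

THE RESIDUAL · `CleanBearingResidual 10` (declared residual of generation 17 if the bundle adopts the cut): unhosted at radius 10, yet carrying a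
robustly clean Barlow site at some admissible spacing `a` — by K3/K9 the clean Barlow sites are then r(Y)-DENSE at that spacing (finite depth),
so the texture is a Barlow MATRIX at spacing `a` that is TORN there (dense exactly-gapped non-Barlow 12-shells) or has CORES THICKER THAN 10 of
bounded depth: thick amorphous / tcp NODULES and BANDS, intergranular films wider than 20, two-phase lamellae, torn inclusions — the door-type
world of the hosted programme at a larger, texture-dependent core radius.  STRICTLY WEAKER than `UnhostedResidual 10` by restriction (it drops
every Barlow-free texture: glasses, tcp/Frank–Kasper phases, quasicrystal-type and non-close-packed crystalline order — the whole list the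
generation-14 docstring gave as the residual's world); ATTACK = depth exclusion (the law on bare balls deep inside a nodule + the boundary
interaction bound + recurrence density of deep nodules ⟹ cube charge > 0, contradicting `cubeChargeLaw`; needs the sitewise cap of crux
`OverbindingCap` (stmt-30249) for the matrix collar) followed by the hosted door laws at the bounded depth.

Deps (tree only): `Theses.OverbindingBudget` (`RobustDefectLimitWindows`, `CubeChargeLaw` by name), `Theorems.OverbindingBudgetCubeChargeLaw`
(`cubeChargeLaw`), `…ExcessInstability` (`finite_inter_cube`), `…ViolatorDensityFloor` (`GT`), `…WallTensionLever` (`BarlowClose`, `MAT`,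
`CleanT`, `ThinCores`, cube geometry K2a–c, transfer lemma `cubeCharge_of_cubeFloor`), `…PatchTransport` (`cleanT_transport`); Literature `MuGSC`
(`UniformlyDiscrete`, `IsMuGSC`), `LennardJonesClusters`, `KissingPatterns` (`EtaMatched.mono`).  No `instance`, no `notation`.
-/

namespace Summit.AtomisticToContinuum.Crystallization.Theorems.OverbindingBudgetCleanlessCut

open scoped BigOperators Topology
open Literature.MathematicalPhysics.StatisticalMechanics (UniformlyDiscrete IsMuGSC lennardJones groundStateEnergy)
open Literature.Geometry.DiscreteGeometry (ShellCloseTo fccKissingPattern hcpKissingPattern EtaMatched)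
open Summit.AtomisticToContinuum.Crystallization.Theses.OverbindingBudget (RobustDefectLimitWindows CubeChargeLaw)
open Summit.AtomisticToContinuum.Crystallization.Theorems.OverbindingBudgetViolatorDensityFloor (GT)
open Summit.AtomisticToContinuum.Crystallization.Theorems.OverbindingBudgetWallTensionLever (BarlowClose MAT CleanT ThinCores cube_convex closedBall_subset_cube cube_subset_closedBall cubeCharge_of_cubeFloor)
open Summit.AtomisticToContinuum.Crystallization.Theorems.OverbindingBudgetExcessInstability (finite_inter_cube)
open Summit.AtomisticToContinuum.Crystallization.Theorems.OverbindingBudgetPatchTransport (cleanT_transport)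
open Summit.AtomisticToContinuum.Crystallization.Theorems.OverbindingBudgetCubeChargeLaw (cubeChargeLaw)

/-! ## §A Predicates -/

/-- `Hosted r₀ Y` (verbatim generation 14, over the tree's `MAT` / `ThinCores`): at some admissible spacing the texture is a thin-cored Barlow
matrix — every exactly clean site is 1/5-Barlow-close and every point of space lies within `r₀` of an exactly clean Barlow-close site. -/
def Hosted (r₀ : ℝ) (Y : Set (EuclideanSpace ℝ (Fin 3))) : Prop :=
  ∃ a : ℝ, 47 / 50 ≤ a ∧ a ≤ 1 ∧ MAT a Y ∧ ThinCores a r₀ Y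

/-- **`UnhostedResidual r₀`** (verbatim generation 14): RDEF's hypotheses ∧ ¬Hosted r₀ Y ⟹ windows.  At `r₀ = 10` this is the REGISTERED residual
stub `stub_unhostedResidual` of line v7 «HostedDustCut» (pin `unhostedResidual_ten_iff`, §E).  UNTOUCHED here: it is CUT (K1) and DERIVED (K6). -/
def UnhostedResidual (r₀ : ℝ) : Prop :=
  ∀ e : ℝ, Filter.Tendsto (fun N : ℕ => Literature.MathematicalPhysics.StatisticalMechanics.groundStateEnergy Literature.MathematicalPhysics.StatisticalMechanics.lennardJones 3 N / N) Filter.atTop (nhds e) → (∀ N : ℕ, 0 < N → e ≤ Literature.MathematicalPhysics.StatisticalMechanics.groundStateEnergy Literature.MathematicalPhysics.StatisticalMechanics.lennardJones 3 N / N) → ∀ x : (N : ℕ) → (Fin N → EuclideanSpace ℝ (Fin 3)), (∀ N, Literature.MathematicalPhysics.StatisticalMechanics.IsGroundState Literature.MathematicalPhysics.StatisticalMechanics.lennardJones (x N)) → ∀ Y : Set (EuclideanSpace ℝ (Fin 3)), (0 : EuclideanSpace ℝ (Fin 3)) ∈ Y → (∀ R ε : ℝ, 0 < ε → ∃ L :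 ℝ, ∀ p ∈ Y, ∀ q ∈ Y, ∃ q' ∈ Y, dist q' q ≤ L ∧ (∀ y ∈ Y, dist y p ≤ R → ∃ y' ∈ Y, dist (y' - q') (y - p) ≤ ε) ∧ (∀ y' ∈ Y, dist y' q' ≤ R → ∃ y ∈ Y, dist (y' - q') (y - p) ≤ ε)) → (∃ (φ : ℕ → ℕ) (t : ℕ → EuclideanSpace ℝ (Fin 3)), StrictMono φ ∧ ∀ R ε : ℝ, 0 < ε → ∀ᶠ n in Filter.atTop, (∀ y ∈ Y, ‖y‖ ≤ R → ∃ i : Fin (φ n), dist (x (φ n) i + t n) y ≤ ε) ∧ (∀ i : Fin (φ n), ‖x (φ n) i + t n‖ ≤ R → ∃ y ∈ Y, dist (x (φ n) i + t n) y ≤ ε)) → Literature.MathematicalPhysics.StatisticalMechanics.UniformlyDiscrete Y → Literature.MathematicalPhysics.StatisticalMechanics.IsMuGSC Literature.MathematicalPhysics.StatisticalMechanics.lennardJones e Y → (¬ (∃ a : ℝ, 47 / 50 ≤ a ∧ a ≤ 1 ∧ ∀ y ∈ Y, ({w ∈ Y | w ≠ y ∧ dist y w ≤ a * (1 + 1 /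 50)}.ncard = 12 ∧ ∀ w ∈ Y, w ≠ y → a * (1 - 1 / 50) ≤ dist y w ∧ (dist y w ≤ a * (1 + 1 / 50) ∨ a * (63 / 50) ≤ dist y w)))) → (∀ z : EuclideanSpace ℝ (Fin 3), ∃ w ∈ Y, dist z w < 9 / 10) → (¬ (∃ W : Literature.MathematicalPhysics.StatisticalMechanics.PeriodicConfiguration 3, W.points = Y)) → (∃ ℓ₀ : ℝ, ∀ ℓ : ℝ, ∀ c : EuclideanSpace ℝ (Fin 3), ℓ₀ ≤ ℓ → ((Y ∩ {z | ∀ i : Fin 3, c i ≤ z i ∧ z i < c i + ℓ}).ncard : ℝ) < 2 * ℓ ^ 3) → (∃ ℓ₀ : ℝ, ∀ ℓ : ℝ, ∀ c : EuclideanSpace ℝ (Fin 3), ℓ₀ ≤ ℓ → 5 / 4 * ℓ ^ 3 < ((Y ∩ {z | ∀ i : Fin 3, c i ≤ z i ∧ z i < c i + ℓ}).ncard : ℝ)) → (¬ (∃ a : ℝ, 47 / 50 ≤ a ∧ a ≤ 1 ∧ ∃ K : ℝ, 0 < K ∧ ∃ c : EuclideanSpace ℝ (Fin 3), (∃ y ∈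 Y, dist y c ≤ K ∧ ¬ (({v ∈ Y | v ≠ y ∧ dist y v ≤ a * (1 + 1 / 10)}.ncard = 12 ∧ ∀ v ∈ Y, v ≠ y → a * (1 - 1 / 10) ≤ dist y v ∧ (dist y v ≤ a * (1 + 1 / 10) ∨ a * (63 / 50) ≤ dist y v)) ∧ (∃ T : Finset (EuclideanSpace ℝ (Fin 3)), (↑T : Set (EuclideanSpace ℝ (Fin 3))) = (fun v => a⁻¹ • (v - y)) '' {v ∈ Y | v ≠ y ∧ dist y v ≤ a * (1 + 1 / 10)} ∧ (Literature.Geometry.DiscreteGeometry.ShellCloseTo (2 / 5) T Literature.Geometry.DiscreteGeometry.fccKissingPattern ∨ Literature.Geometry.DiscreteGeometry.ShellCloseTo (2 / 5) T Literature.Geometry.DiscreteGeometry.hcpKissingPattern)))) ∧ (∀ w ∈ Y, K < dist w c → dist w c ≤ 4 * K + 6 → (({v ∈ Y | v ≠ w ∧ dist w v ≤ a * (1 + 1 / 50)}.ncard = 12 ∧ ∀ v ∈ Y, v ≠ w → a * (1 - 1 / 50) ≤ dist w v ∧ (dist w v ≤ a * (1 + 1 / 50) ∨ a * (63 / 50)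 ≤ dist w v)) ∧ (∃ T : Finset (EuclideanSpace ℝ (Fin 3)), (↑T : Set (EuclideanSpace ℝ (Fin 3))) = (fun v => a⁻¹ • (v - w)) '' {v ∈ Y | v ≠ w ∧ dist w v ≤ a * (1 + 1 / 50)} ∧ (Literature.Geometry.DiscreteGeometry.ShellCloseTo (1 / 5) T Literature.Geometry.DiscreteGeometry.fccKissingPattern ∨ Literature.Geometry.DiscreteGeometry.ShellCloseTo (1 / 5) T Literature.Geometry.DiscreteGeometry.hcpKissingPattern)))))) → ((∃ y ∈ Y, (∑' w : ↥Y, Literature.MathematicalPhysics.StatisticalMechanics.lennardJones (dist y (w : EuclideanSpace ℝ (Fin 3)))) < 2 * e) ∧ (∃ y ∈ Y, 2 * e < (∑' w : ↥Y, Literature.MathematicalPhysics.StatisticalMechanics.lennardJones (dist y (w : EuclideanSpace ℝ (Fin 3)))))) → (¬ (∃ κ : ℝ, 0 < κ ∧ (∀ ℓ₀ : ℝ, ∃ ℓ : ℝ, ℓ₀ ≤ ℓ ∧ ∃ c : EuclideanSpace ℝ (Fin 3), ∃ F : Finset (EuclideanSpace ℝ (Fin 3)), (↑F : Set (EuclideanSpace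 ℝ (Fin 3))) = Y ∩ {z | ∀ i : Fin 3, c i ≤ z i ∧ z i < c i + ℓ} ∧ ∃ H : Finset (EuclideanSpace ℝ (Fin 3)), H ⊆ F ∧ 1 / 8 * ((F.card : ℝ) - (H.card : ℝ)) + κ * (F.card : ℝ) ≤ ∑ y ∈ H, ((∑' w : ↥Y, Literature.MathematicalPhysics.StatisticalMechanics.lennardJones (dist y (w : EuclideanSpace ℝ (Fin 3)))) - 2 * e)))) → (∃ L t : ℝ, 0 < t ∧ ∀ q ∈ Y, ∀ a : ℝ, 47 / 50 ≤ a → a ≤ 1 → ∃ y ∈ Y, dist y q ≤ L ∧ ¬ ({w ∈ Y | w ≠ y ∧ dist y w < a * (63 / 50) - t}.ncard ≤ 12 ∧ 12 ≤ {w ∈ Y | w ≠ y ∧ dist y w ≤ a * (1 + 1 / 50) + t}.ncard ∧ ∀ w ∈ Y, w ≠ y → a * (1 - 1 / 50) - t ≤ dist y w ∧ (dist y w ≤ a * (1 + 1 / 50) + t ∨ a * (63 / 50) - t ≤ dist y w))) → ¬ (∃ a : ℝ, 47 / 50 ≤ a ∧ a ≤ 1 ∧ (∀ y ∈ Y, ({w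 ∈ Y | w ≠ y ∧ dist y w ≤ a * (1 + 1 / 50)}.ncard = 12 ∧ ∀ w ∈ Y, w ≠ y → a * (1 - 1 / 50) ≤ dist y w ∧ (dist y w ≤ a * (1 + 1 / 50) ∨ a * (63 / 50) ≤ dist y w)) → (∃ T : Finset (EuclideanSpace ℝ (Fin 3)), (↑T : Set (EuclideanSpace ℝ (Fin 3))) = (fun w => a⁻¹ • (w - y)) '' {w ∈ Y | w ≠ y ∧ dist y w ≤ a * (1 + 1 / 50)} ∧ (Literature.Geometry.DiscreteGeometry.ShellCloseTo (1 / 5) T Literature.Geometry.DiscreteGeometry.fccKissingPattern ∨ Literature.Geometry.DiscreteGeometry.ShellCloseTo (1 / 5) T Literature.Geometry.DiscreteGeometry.hcpKissingPattern))) ∧ (∀ z : EuclideanSpace ℝ (Fin 3), ∃ y ∈ Y, ({w ∈ Y | w ≠ y ∧ dist y w ≤ a * (1 + 1 / 50)}.ncard = 12 ∧ ∀ w ∈ Y, w ≠ y → a * (1 - 1 / 50) ≤ dist y w ∧ (dist y w ≤ a * (1 + 1 / 50) ∨ a * (63 / 50) ≤ dist y w)) ∧ (∃ T : Finset (EuclideanSpace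 ℝ (Fin 3)), (↑T : Set (EuclideanSpace ℝ (Fin 3))) = (fun w => a⁻¹ • (w - y)) '' {w ∈ Y | w ≠ y ∧ dist y w ≤ a * (1 + 1 / 50)} ∧ (Literature.Geometry.DiscreteGeometry.ShellCloseTo (1 / 5) T Literature.Geometry.DiscreteGeometry.fccKissingPattern ∨ Literature.Geometry.DiscreteGeometry.ShellCloseTo (1 / 5) T Literature.Geometry.DiscreteGeometry.hcpKissingPattern)) ∧ dist z y ≤ r₀)) → ∃ W : Literature.MathematicalPhysics.StatisticalMechanics.PeriodicConfiguration 3, ∀ R ε : ℝ, 0 < ε → ∃ᶠ N in Filter.atTop, ∃ t : EuclideanSpace ℝ (Fin 3), (∀ s ∈ W.points, ‖s‖ ≤ R → ∃ i : Fin N, dist (x N i + t) s ≤ ε) ∧ (∀ i : Fin N, ‖x N i + t‖ ≤ R → ∃ s ∈ W.points, dist (x N i + t) s ≤ ε)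

/-- `HostedTarget r₀` (verbatim generation 14): RDEF restricted to hosted textures. -/
def HostedTarget (r₀ : ℝ) : Prop :=
  ∀ e : ℝ, Filter.Tendsto (fun N : ℕ => Literature.MathematicalPhysics.StatisticalMechanics.groundStateEnergy Literature.MathematicalPhysics.StatisticalMechanics.lennardJones 3 N / N) Filter.atTop (nhds e) → (∀ N : ℕ, 0 < N → e ≤ Literature.MathematicalPhysics.StatisticalMechanics.groundStateEnergy Literature.MathematicalPhysics.StatisticalMechanics.lennardJones 3 N / N) → ∀ x : (N : ℕ) → (Fin N → EuclideanSpace ℝ (Fin 3)), (∀ N, Literature.MathematicalPhysics.StatisticalMechanics.IsGroundState Literature.MathematicalPhysics.StatisticalMechanics.lennardJones (x N)) → ∀ Y : Set (EuclideanSpace ℝ (Fin 3)), (0 : EuclideanSpace ℝ (Fin 3)) ∈ Y → (∀ R ε : ℝ, 0 < ε → ∃ L : ℝ, ∀ p ∈ Y, ∀ q ∈ Y, ∃ q' ∈ Y, dist q' q ≤ L ∧ (∀ y ∈ Y, dist y p ≤ R → ∃ y' ∈ Y, dist (y' - q') (y - p) ≤ ε) ∧ (∀ y' ∈ Y, dist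 y' q' ≤ R → ∃ y ∈ Y, dist (y' - q') (y - p) ≤ ε)) → (∃ (φ : ℕ → ℕ) (t : ℕ → EuclideanSpace ℝ (Fin 3)), StrictMono φ ∧ ∀ R ε : ℝ, 0 < ε → ∀ᶠ n in Filter.atTop, (∀ y ∈ Y, ‖y‖ ≤ R → ∃ i : Fin (φ n), dist (x (φ n) i + t n) y ≤ ε) ∧ (∀ i : Fin (φ n), ‖x (φ n) i + t n‖ ≤ R → ∃ y ∈ Y, dist (x (φ n) i + t n) y ≤ ε)) → Literature.MathematicalPhysics.StatisticalMechanics.UniformlyDiscrete Y → Literature.MathematicalPhysics.StatisticalMechanics.IsMuGSC Literature.MathematicalPhysics.StatisticalMechanics.lennardJones e Y → (¬ (∃ a : ℝ, 47 / 50 ≤ a ∧ a ≤ 1 ∧ ∀ y ∈ Y, ({w ∈ Y | w ≠ y ∧ dist y w ≤ a * (1 + 1 / 50)}.ncard = 12 ∧ ∀ w ∈ Y, w ≠ y → a * (1 - 1 / 50) ≤ dist y w ∧ (dist y w ≤ a * (1 + 1 / 50) ∨ a * (63 / 50) ≤ dist y w)))) → (∀ z : EuclideanSpace ℝ (Fin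 3), ∃ w ∈ Y, dist z w < 9 / 10) → (¬ (∃ W : Literature.MathematicalPhysics.StatisticalMechanics.PeriodicConfiguration 3, W.points = Y)) → (∃ ℓ₀ : ℝ, ∀ ℓ : ℝ, ∀ c : EuclideanSpace ℝ (Fin 3), ℓ₀ ≤ ℓ → ((Y ∩ {z | ∀ i : Fin 3, c i ≤ z i ∧ z i < c i + ℓ}).ncard : ℝ) < 2 * ℓ ^ 3) → (∃ ℓ₀ : ℝ, ∀ ℓ : ℝ, ∀ c : EuclideanSpace ℝ (Fin 3), ℓ₀ ≤ ℓ → 5 / 4 * ℓ ^ 3 < ((Y ∩ {z | ∀ i : Fin 3, c i ≤ z i ∧ z i < c i + ℓ}).ncard : ℝ)) → (¬ (∃ a : ℝ, 47 / 50 ≤ a ∧ a ≤ 1 ∧ ∃ K : ℝ, 0 < K ∧ ∃ c : EuclideanSpace ℝ (Fin 3), (∃ y ∈ Y, dist y c ≤ K ∧ ¬ (({v ∈ Y | v ≠ y ∧ dist y v ≤ a * (1 + 1 / 10)}.ncard = 12 ∧ ∀ v ∈ Y, v ≠ y → a * (1 - 1 / 10) ≤ dist y v ∧ (dist y v ≤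 a * (1 + 1 / 10) ∨ a * (63 / 50) ≤ dist y v)) ∧ (∃ T : Finset (EuclideanSpace ℝ (Fin 3)), (↑T : Set (EuclideanSpace ℝ (Fin 3))) = (fun v => a⁻¹ • (v - y)) '' {v ∈ Y | v ≠ y ∧ dist y v ≤ a * (1 + 1 / 10)} ∧ (Literature.Geometry.DiscreteGeometry.ShellCloseTo (2 / 5) T Literature.Geometry.DiscreteGeometry.fccKissingPattern ∨ Literature.Geometry.DiscreteGeometry.ShellCloseTo (2 / 5) T Literature.Geometry.DiscreteGeometry.hcpKissingPattern)))) ∧ (∀ w ∈ Y, K < dist w c → dist w c ≤ 4 * K + 6 → (({v ∈ Y | v ≠ w ∧ dist w v ≤ a * (1 + 1 / 50)}.ncard = 12 ∧ ∀ v ∈ Y, v ≠ w → a * (1 - 1 / 50) ≤ dist w v ∧ (dist w v ≤ a * (1 + 1 / 50) ∨ a * (63 / 50) ≤ dist w v)) ∧ (∃ T : Finset (EuclideanSpace ℝ (Fin 3)), (↑T : Set (EuclideanSpace ℝ (Fin 3))) = (fun v => a⁻¹ • (v - w)) '' {v ∈ Y | v ≠ w ∧ dist w v ≤ a * (1 +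 1 / 50)} ∧ (Literature.Geometry.DiscreteGeometry.ShellCloseTo (1 / 5) T Literature.Geometry.DiscreteGeometry.fccKissingPattern ∨ Literature.Geometry.DiscreteGeometry.ShellCloseTo (1 / 5) T Literature.Geometry.DiscreteGeometry.hcpKissingPattern)))))) → ((∃ y ∈ Y, (∑' w : ↥Y, Literature.MathematicalPhysics.StatisticalMechanics.lennardJones (dist y (w : EuclideanSpace ℝ (Fin 3)))) < 2 * e) ∧ (∃ y ∈ Y, 2 * e < (∑' w : ↥Y, Literature.MathematicalPhysics.StatisticalMechanics.lennardJones (dist y (w : EuclideanSpace ℝ (Fin 3)))))) → (¬ (∃ κ : ℝ, 0 < κ ∧ (∀ ℓ₀ : ℝ, ∃ ℓ : ℝ, ℓ₀ ≤ ℓ ∧ ∃ c : EuclideanSpace ℝ (Fin 3), ∃ F : Finset (EuclideanSpace ℝ (Fin 3)), (↑F : Set (EuclideanSpace ℝ (Fin 3))) = Y ∩ {z | ∀ i : Fin 3, c i ≤ z i ∧ z i < c i + ℓ} ∧ ∃ H : Finset (EuclideanSpace ℝ (Fin 3)), H ⊆ F ∧ 1 / 8 * ((F.card : ℝ) - (H.card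 : ℝ)) + κ * (F.card : ℝ) ≤ ∑ y ∈ H, ((∑' w : ↥Y, Literature.MathematicalPhysics.StatisticalMechanics.lennardJones (dist y (w : EuclideanSpace ℝ (Fin 3)))) - 2 * e)))) → (∃ L t : ℝ, 0 < t ∧ ∀ q ∈ Y, ∀ a : ℝ, 47 / 50 ≤ a → a ≤ 1 → ∃ y ∈ Y, dist y q ≤ L ∧ ¬ ({w ∈ Y | w ≠ y ∧ dist y w < a * (63 / 50) - t}.ncard ≤ 12 ∧ 12 ≤ {w ∈ Y | w ≠ y ∧ dist y w ≤ a * (1 + 1 / 50) + t}.ncard ∧ ∀ w ∈ Y, w ≠ y → a * (1 - 1 / 50) - t ≤ dist y w ∧ (dist y w ≤ a * (1 + 1 / 50) + t ∨ a * (63 / 50) - t ≤ dist y w))) → (∃ a : ℝ, 47 / 50 ≤ a ∧ a ≤ 1 ∧ (∀ y ∈ Y, ({w ∈ Y | w ≠ y ∧ dist y w ≤ a * (1 + 1 / 50)}.ncard = 12 ∧ ∀ w ∈ Y, w ≠ y → a * (1 - 1 / 50) ≤ dist y w ∧ (dist y w ≤ a * (1 + 1 / 50) ∨ a * (63 / 50)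 ≤ dist y w)) → (∃ T : Finset (EuclideanSpace ℝ (Fin 3)), (↑T : Set (EuclideanSpace ℝ (Fin 3))) = (fun w => a⁻¹ • (w - y)) '' {w ∈ Y | w ≠ y ∧ dist y w ≤ a * (1 + 1 / 50)} ∧ (Literature.Geometry.DiscreteGeometry.ShellCloseTo (1 / 5) T Literature.Geometry.DiscreteGeometry.fccKissingPattern ∨ Literature.Geometry.DiscreteGeometry.ShellCloseTo (1 / 5) T Literature.Geometry.DiscreteGeometry.hcpKissingPattern))) ∧ (∀ z : EuclideanSpace ℝ (Fin 3), ∃ y ∈ Y, ({w ∈ Y | w ≠ y ∧ dist y w ≤ a * (1 + 1 / 50)}.ncard = 12 ∧ ∀ w ∈ Y, w ≠ y → a * (1 - 1 / 50) ≤ dist y w ∧ (dist y w ≤ a * (1 + 1 / 50) ∨ a * (63 / 50) ≤ dist y w)) ∧ (∃ T : Finset (EuclideanSpace ℝ (Fin 3)), (↑T : Set (EuclideanSpace ℝ (Fin 3))) = (fun w => a⁻¹ • (w - y)) '' {w ∈ Y | w ≠ y ∧ dist y w ≤ a * (1 + 1 / 50)} ∧ (Literature.Geometry.DiscreteGeometry.ShellCloseTo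 (1 / 5) T Literature.Geometry.DiscreteGeometry.fccKissingPattern ∨ Literature.Geometry.DiscreteGeometry.ShellCloseTo (1 / 5) T Literature.Geometry.DiscreteGeometry.hcpKissingPattern)) ∧ dist z y ≤ r₀)) → ∃ W : Literature.MathematicalPhysics.StatisticalMechanics.PeriodicConfiguration 3, ∀ R ε : ℝ, 0 < ε → ∃ᶠ N in Filter.atTop, ∃ t : EuclideanSpace ℝ (Fin 3), (∀ s ∈ W.points, ‖s‖ ≤ R → ∃ i : Fin N, dist (x N i + t) s ≤ ε) ∧ (∀ i : Fin N, ‖x N i + t‖ ≤ R → ∃ s ∈ W.points, dist (x N i + t) s ≤ ε)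

/-- **THE CUT LITERAL · `CleanBearing Y`**: at some admissible spacing `a ∈ [47/50, 1]` some site of `Y` is t-ROBUSTLY clean Barlow for some
margin `t > 0` (twelve neighbours in the window `[0.98a + t, 1.02a − t]`, gap to `1.26a + t`, rescaled shell `(1/5 − t)`-close to a kissing
pattern).  Robust (not exact) cleanness is what two-way recurrence transports (K3); its negation «Barlow-free» is what the law prices. -/
def CleanBearing (Y : Set (EuclideanSpace ℝ (Fin 3))) : Prop :=
  ∃ a : ℝ, 47 / 50 ≤ a ∧ a ≤ 1 ∧ ∃ t : ℝ, 0 < t ∧ ∃ y ∈ Y, CleanT a t Y y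

/-- **Piece · `CleanlessPiece r₀`** (crux-shaped; VACUOUS GIVEN THE LAW, K5): RDEF's hypotheses ∧ ¬Hosted r₀ ∧ ¬CleanBearing ⟹ windows.
World = BARLOW-FREE textures: no robustly clean Barlow site at any admissible spacing — glasses, polytetrahedral / Frank–Kasper / icosahedral
order, quasicrystal-type order, bcc / sc / diamond-type packings, Barlow crystals strained or modulated out of the window everywhere. -/
def CleanlessPiece (r₀ : ℝ) : Prop :=
  ∀ e : ℝ, Filter.Tendsto (fun N : ℕ => Literature.MathematicalPhysics.StatisticalMechanics.groundStateEnergy Literature.MathematicalPhysics.StatisticalMechanics.lennardJones 3 N / N) Filter.atTop (nhds e) → (∀ N : ℕ, 0 < N → e ≤ Literature.MathematicalPhysics.StatisticalMechanics.groundStateEnergy Literature.MathematicalPhysics.StatisticalMechanics.lennardJones 3 N / N) → ∀ x : (N : ℕ) → (Fin N → EuclideanSpace ℝ (Fin 3)), (∀ N, Literature.MathematicalPhysics.StatisticalMechanics.IsGroundState Literature.MathematicalPhysics.StatisticalMechanics.lennardJones (x N)) → ∀ Y : Set (EuclideanSpace ℝ (Fin 3)), (0 : EuclideanSpace ℝ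 (Fin 3)) ∈ Y → (∀ R ε : ℝ, 0 < ε → ∃ L : ℝ, ∀ p ∈ Y, ∀ q ∈ Y, ∃ q' ∈ Y, dist q' q ≤ L ∧ (∀ y ∈ Y, dist y p ≤ R → ∃ y' ∈ Y, dist (y' - q') (y - p) ≤ ε) ∧ (∀ y' ∈ Y, dist y' q' ≤ R → ∃ y ∈ Y, dist (y' - q') (y - p) ≤ ε)) → (∃ (φ : ℕ → ℕ) (t : ℕ → EuclideanSpace ℝ (Fin 3)), StrictMono φ ∧ ∀ R ε : ℝ, 0 < ε → ∀ᶠ n in Filter.atTop, (∀ y ∈ Y, ‖y‖ ≤ R → ∃ i : Fin (φ n), dist (x (φ n) i + t n) y ≤ ε) ∧ (∀ i : Fin (φ n), ‖x (φ n) i + t n‖ ≤ R → ∃ y ∈ Y, dist (x (φ n) i + t n) y ≤ ε)) → Literature.MathematicalPhysics.StatisticalMechanics.UniformlyDiscrete Y → Literature.MathematicalPhysics.StatisticalMechanics.IsMuGSC Literature.MathematicalPhysics.StatisticalMechanics.lennardJones e Y → (¬ (∃ a : ℝ, 47 / 50 ≤ a ∧ a ≤ 1 ∧ ∀ y ∈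 Y, ({w ∈ Y | w ≠ y ∧ dist y w ≤ a * (1 + 1 / 50)}.ncard = 12 ∧ ∀ w ∈ Y, w ≠ y → a * (1 - 1 / 50) ≤ dist y w ∧ (dist y w ≤ a * (1 + 1 / 50) ∨ a * (63 / 50) ≤ dist y w)))) → (∀ z : EuclideanSpace ℝ (Fin 3), ∃ w ∈ Y, dist z w < 9 / 10) → (¬ (∃ W : Literature.MathematicalPhysics.StatisticalMechanics.PeriodicConfiguration 3, W.points = Y)) → (∃ ℓ₀ : ℝ, ∀ ℓ : ℝ, ∀ c : EuclideanSpace ℝ (Fin 3), ℓ₀ ≤ ℓ → ((Y ∩ {z | ∀ i : Fin 3, c i ≤ z i ∧ z i < c i + ℓ}).ncard : ℝ) < 2 * ℓ ^ 3) → (∃ ℓ₀ : ℝ, ∀ ℓ : ℝ, ∀ c : EuclideanSpace ℝ (Fin 3), ℓ₀ ≤ ℓ → 5 / 4 * ℓ ^ 3 < ((Y ∩ {z | ∀ i : Fin 3, c i ≤ z i ∧ z i < c i + ℓ}).ncard : ℝ)) → (¬ (∃ a : ℝ, 47 / 50 ≤ a ∧ a ≤ 1 ∧ ∃ K : ℝ,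 0 < K ∧ ∃ c : EuclideanSpace ℝ (Fin 3), (∃ y ∈ Y, dist y c ≤ K ∧ ¬ (({v ∈ Y | v ≠ y ∧ dist y v ≤ a * (1 + 1 / 10)}.ncard = 12 ∧ ∀ v ∈ Y, v ≠ y → a * (1 - 1 / 10) ≤ dist y v ∧ (dist y v ≤ a * (1 + 1 / 10) ∨ a * (63 / 50) ≤ dist y v)) ∧ (∃ T : Finset (EuclideanSpace ℝ (Fin 3)), (↑T : Set (EuclideanSpace ℝ (Fin 3))) = (fun v => a⁻¹ • (v - y)) '' {v ∈ Y | v ≠ y ∧ dist y v ≤ a * (1 + 1 / 10)} ∧ (Literature.Geometry.DiscreteGeometry.ShellCloseTo (2 / 5) T Literature.Geometry.DiscreteGeometry.fccKissingPattern ∨ Literature.Geometry.DiscreteGeometry.ShellCloseTo (2 / 5) T Literature.Geometry.DiscreteGeometry.hcpKissingPattern)))) ∧ (∀ w ∈ Y, K < dist w c → dist w c ≤ 4 * K + 6 → (({v ∈ Y | v ≠ w ∧ dist w v ≤ a * (1 + 1 / 50)}.ncard = 12 ∧ ∀ v ∈ Y, v ≠ w → a * (1 - 1 / 50) ≤ dist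 w v ∧ (dist w v ≤ a * (1 + 1 / 50) ∨ a * (63 / 50) ≤ dist w v)) ∧ (∃ T : Finset (EuclideanSpace ℝ (Fin 3)), (↑T : Set (EuclideanSpace ℝ (Fin 3))) = (fun v => a⁻¹ • (v - w)) '' {v ∈ Y | v ≠ w ∧ dist w v ≤ a * (1 + 1 / 50)} ∧ (Literature.Geometry.DiscreteGeometry.ShellCloseTo (1 / 5) T Literature.Geometry.DiscreteGeometry.fccKissingPattern ∨ Literature.Geometry.DiscreteGeometry.ShellCloseTo (1 / 5) T Literature.Geometry.DiscreteGeometry.hcpKissingPattern)))))) → ((∃ y ∈ Y, (∑' w : ↥Y, Literature.MathematicalPhysics.StatisticalMechanics.lennardJones (dist y (w : EuclideanSpace ℝ (Fin 3)))) < 2 * e) ∧ (∃ y ∈ Y, 2 * e < (∑' w : ↥Y, Literature.MathematicalPhysics.StatisticalMechanics.lennardJones (dist y (w : EuclideanSpace ℝ (Fin 3)))))) → (¬ (∃ κ : ℝ, 0 < κ ∧ (∀ ℓ₀ : ℝ, ∃ ℓ : ℝ, ℓ₀ ≤ ℓ ∧ ∃ c : EuclideanSpace ℝ (Fin 3), ∃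 F : Finset (EuclideanSpace ℝ (Fin 3)), (↑F : Set (EuclideanSpace ℝ (Fin 3))) = Y ∩ {z | ∀ i : Fin 3, c i ≤ z i ∧ z i < c i + ℓ} ∧ ∃ H : Finset (EuclideanSpace ℝ (Fin 3)), H ⊆ F ∧ 1 / 8 * ((F.card : ℝ) - (H.card : ℝ)) + κ * (F.card : ℝ) ≤ ∑ y ∈ H, ((∑' w : ↥Y, Literature.MathematicalPhysics.StatisticalMechanics.lennardJones (dist y (w : EuclideanSpace ℝ (Fin 3)))) - 2 * e)))) → (∃ L t : ℝ, 0 < t ∧ ∀ q ∈ Y, ∀ a : ℝ, 47 / 50 ≤ a → a ≤ 1 → ∃ y ∈ Y, dist y q ≤ L ∧ ¬ ({w ∈ Y | w ≠ y ∧ dist y w < a * (63 / 50) - t}.ncard ≤ 12 ∧ 12 ≤ {w ∈ Y | w ≠ y ∧ dist y w ≤ a * (1 + 1 / 50) + t}.ncard ∧ ∀ w ∈ Y, w ≠ y → a * (1 - 1 / 50) - t ≤ dist y w ∧ (dist y w ≤ a * (1 + 1 / 50) + t ∨ a * (63 / 50) - t ≤ dist y w))) → ¬ (∃ a : ℝ,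 47 / 50 ≤ a ∧ a ≤ 1 ∧ (∀ y ∈ Y, ({w ∈ Y | w ≠ y ∧ dist y w ≤ a * (1 + 1 / 50)}.ncard = 12 ∧ ∀ w ∈ Y, w ≠ y → a * (1 - 1 / 50) ≤ dist y w ∧ (dist y w ≤ a * (1 + 1 / 50) ∨ a * (63 / 50) ≤ dist y w)) → (∃ T : Finset (EuclideanSpace ℝ (Fin 3)), (↑T : Set (EuclideanSpace ℝ (Fin 3))) = (fun w => a⁻¹ • (w - y)) '' {w ∈ Y | w ≠ y ∧ dist y w ≤ a * (1 + 1 / 50)} ∧ (Literature.Geometry.DiscreteGeometry.ShellCloseTo (1 / 5) T Literature.Geometry.DiscreteGeometry.fccKissingPattern ∨ Literature.Geometry.DiscreteGeometry.ShellCloseTo (1 / 5) T Literature.Geometry.DiscreteGeometry.hcpKissingPattern))) ∧ (∀ z : EuclideanSpace ℝ (Fin 3), ∃ y ∈ Y, ({w ∈ Y | w ≠ y ∧ dist y w ≤ a * (1 + 1 / 50)}.ncard = 12 ∧ ∀ w ∈ Y, w ≠ y → a * (1 - 1 / 50) ≤ dist y w ∧ (dist y w ≤ a * (1 + 1 / 50)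 ∨ a * (63 / 50) ≤ dist y w)) ∧ (∃ T : Finset (EuclideanSpace ℝ (Fin 3)), (↑T : Set (EuclideanSpace ℝ (Fin 3))) = (fun w => a⁻¹ • (w - y)) '' {w ∈ Y | w ≠ y ∧ dist y w ≤ a * (1 + 1 / 50)} ∧ (Literature.Geometry.DiscreteGeometry.ShellCloseTo (1 / 5) T Literature.Geometry.DiscreteGeometry.fccKissingPattern ∨ Literature.Geometry.DiscreteGeometry.ShellCloseTo (1 / 5) T Literature.Geometry.DiscreteGeometry.hcpKissingPattern)) ∧ dist z y ≤ r₀)) → ¬ (∃ a : ℝ, 47 / 50 ≤ a ∧ a ≤ 1 ∧ ∃ t : ℝ, 0 < t ∧ ∃ y ∈ Y, ({w ∈ Y | w ≠ y ∧ dist y w ≤ a * (1 + 1 / 50) - t}.ncard = 12 ∧ (∀ w ∈ Y, w ≠ y → a * (1 - 1 / 50) + t ≤ dist y w ∧ (dist y w ≤ a * (1 + 1 / 50) - t ∨ a * (63 / 50) + t ≤ dist y w)) ∧ (∃ T : Finset (EuclideanSpace ℝ (Fin 3)), (↑T : Set (EuclideanSpace ℝ (Fin 3))) = (fun w => a⁻¹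 • (w - y)) '' {w ∈ Y | w ≠ y ∧ dist y w ≤ a * (1 + 1 / 50)} ∧ (Literature.Geometry.DiscreteGeometry.ShellCloseTo (1 / 5 - t) T Literature.Geometry.DiscreteGeometry.fccKissingPattern ∨ Literature.Geometry.DiscreteGeometry.ShellCloseTo (1 / 5 - t) T Literature.Geometry.DiscreteGeometry.hcpKissingPattern)))) → ∃ W : Literature.MathematicalPhysics.StatisticalMechanics.PeriodicConfiguration 3, ∀ R ε : ℝ, 0 < ε → ∃ᶠ N in Filter.atTop, ∃ t : EuclideanSpace ℝ (Fin 3), (∀ s ∈ W.points, ‖s‖ ≤ R → ∃ i : Fin N, dist (x N i + t) s ≤ ε) ∧ (∀ i : Fin N, ‖x N i + t‖ ≤ R → ∃ s ∈ W.points, dist (x N i + t) s ≤ ε)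

/-- **Residual · `CleanBearingResidual r₀`** (THE declared residual of generation 17 = normal form N5 of the minimal counterexample, ONE literal
beyond `UnhostedResidual r₀`): RDEF's hypotheses ∧ ¬Hosted r₀ ∧ CleanBearing ⟹ windows.  «The minimal counterexample has no host at radius r₀, but
carries Barlow order: at some admissible spacing its clean Barlow sites are r-dense for some finite r (K9) — it is torn there, or its cores are
thicker than r₀ but of bounded depth.» -/
def CleanBearingResidual (r₀ : ℝ) : Prop :=
  ∀ e : ℝ, Filter.Tendsto (fun N : ℕ => Literature.MathematicalPhysics.StatisticalMechanics.groundStateEnergy Literature.MathematicalPhysics.StatisticalMechanics.lennardJones 3 N / N) Filter.atTop (nhds e) → (∀ N : ℕ, 0 < N → e ≤ Literature.MathematicalPhysics.StatisticalMechanics.groundStateEnergy Literature.MathematicalPhysics.StatisticalMechanics.lennardJones 3 N / N) → ∀ x : (N : ℕ) → (Fin N → EuclideanSpace ℝ (Fin 3)), (∀ N, Literature.MathematicalPhysics.StatisticalMechanics.IsGroundState Literature.MathematicalPhysics.StatisticalMechanics.lennardJones (x N)) → ∀ Y : Set (EuclideanSpace ℝ (Fin 3)), (0 : EuclideanSpace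 ℝ (Fin 3)) ∈ Y → (∀ R ε : ℝ, 0 < ε → ∃ L : ℝ, ∀ p ∈ Y, ∀ q ∈ Y, ∃ q' ∈ Y, dist q' q ≤ L ∧ (∀ y ∈ Y, dist y p ≤ R → ∃ y' ∈ Y, dist (y' - q') (y - p) ≤ ε) ∧ (∀ y' ∈ Y, dist y' q' ≤ R → ∃ y ∈ Y, dist (y' - q') (y - p) ≤ ε)) → (∃ (φ : ℕ → ℕ) (t : ℕ → EuclideanSpace ℝ (Fin 3)), StrictMono φ ∧ ∀ R ε : ℝ, 0 < ε → ∀ᶠ n in Filter.atTop, (∀ y ∈ Y, ‖y‖ ≤ R → ∃ i : Fin (φ n), dist (x (φ n) i + t n) y ≤ ε) ∧ (∀ i : Fin (φ n), ‖x (φ n) i + t n‖ ≤ R → ∃ y ∈ Y, dist (x (φ n) i + t n) y ≤ ε)) → Literature.MathematicalPhysics.StatisticalMechanics.UniformlyDiscrete Y → Literature.MathematicalPhysics.StatisticalMechanics.IsMuGSC Literature.MathematicalPhysics.StatisticalMechanics.lennardJones e Y → (¬ (∃ a : ℝ, 47 / 50 ≤ a ∧ a ≤ 1 ∧ ∀ y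 ∈ Y, ({w ∈ Y | w ≠ y ∧ dist y w ≤ a * (1 + 1 / 50)}.ncard = 12 ∧ ∀ w ∈ Y, w ≠ y → a * (1 - 1 / 50) ≤ dist y w ∧ (dist y w ≤ a * (1 + 1 / 50) ∨ a * (63 / 50) ≤ dist y w)))) → (∀ z : EuclideanSpace ℝ (Fin 3), ∃ w ∈ Y, dist z w < 9 / 10) → (¬ (∃ W : Literature.MathematicalPhysics.StatisticalMechanics.PeriodicConfiguration 3, W.points = Y)) → (∃ ℓ₀ : ℝ, ∀ ℓ : ℝ, ∀ c : EuclideanSpace ℝ (Fin 3), ℓ₀ ≤ ℓ → ((Y ∩ {z | ∀ i : Fin 3, c i ≤ z i ∧ z i < c i + ℓ}).ncard : ℝ) < 2 * ℓ ^ 3) → (∃ ℓ₀ : ℝ, ∀ ℓ : ℝ, ∀ c : EuclideanSpace ℝ (Fin 3), ℓ₀ ≤ ℓ → 5 / 4 * ℓ ^ 3 < ((Y ∩ {z | ∀ i : Fin 3, c i ≤ z i ∧ z i < c i + ℓ}).ncard : ℝ)) → (¬ (∃ a : ℝ, 47 / 50 ≤ a ∧ a ≤ 1 ∧ ∃ K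 : ℝ, 0 < K ∧ ∃ c : EuclideanSpace ℝ (Fin 3), (∃ y ∈ Y, dist y c ≤ K ∧ ¬ (({v ∈ Y | v ≠ y ∧ dist y v ≤ a * (1 + 1 / 10)}.ncard = 12 ∧ ∀ v ∈ Y, v ≠ y → a * (1 - 1 / 10) ≤ dist y v ∧ (dist y v ≤ a * (1 + 1 / 10) ∨ a * (63 / 50) ≤ dist y v)) ∧ (∃ T : Finset (EuclideanSpace ℝ (Fin 3)), (↑T : Set (EuclideanSpace ℝ (Fin 3))) = (fun v => a⁻¹ • (v - y)) '' {v ∈ Y | v ≠ y ∧ dist y v ≤ a * (1 + 1 / 10)} ∧ (Literature.Geometry.DiscreteGeometry.ShellCloseTo (2 / 5) T Literature.Geometry.DiscreteGeometry.fccKissingPattern ∨ Literature.Geometry.DiscreteGeometry.ShellCloseTo (2 / 5) T Literature.Geometry.DiscreteGeometry.hcpKissingPattern)))) ∧ (∀ w ∈ Y, K < dist w c → dist w c ≤ 4 * K + 6 → (({v ∈ Y | v ≠ w ∧ dist w v ≤ a * (1 + 1 / 50)}.ncard = 12 ∧ ∀ v ∈ Y, v ≠ w → a * (1 - 1 / 50)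 ≤ dist w v ∧ (dist w v ≤ a * (1 + 1 / 50) ∨ a * (63 / 50) ≤ dist w v)) ∧ (∃ T : Finset (EuclideanSpace ℝ (Fin 3)), (↑T : Set (EuclideanSpace ℝ (Fin 3))) = (fun v => a⁻¹ • (v - w)) '' {v ∈ Y | v ≠ w ∧ dist w v ≤ a * (1 + 1 / 50)} ∧ (Literature.Geometry.DiscreteGeometry.ShellCloseTo (1 / 5) T Literature.Geometry.DiscreteGeometry.fccKissingPattern ∨ Literature.Geometry.DiscreteGeometry.ShellCloseTo (1 / 5) T Literature.Geometry.DiscreteGeometry.hcpKissingPattern)))))) → ((∃ y ∈ Y, (∑' w : ↥Y, Literature.MathematicalPhysics.StatisticalMechanics.lennardJones (dist y (w : EuclideanSpace ℝ (Fin 3)))) < 2 * e) ∧ (∃ y ∈ Y, 2 * e < (∑' w : ↥Y, Literature.MathematicalPhysics.StatisticalMechanics.lennardJones (dist y (w : EuclideanSpace ℝ (Fin 3)))))) → (¬ (∃ κ : ℝ, 0 < κ ∧ (∀ ℓ₀ : ℝ, ∃ ℓ : ℝ, ℓ₀ ≤ ℓ ∧ ∃ c : EuclideanSpace ℝ (Fin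 3), ∃ F : Finset (EuclideanSpace ℝ (Fin 3)), (↑F : Set (EuclideanSpace ℝ (Fin 3))) = Y ∩ {z | ∀ i : Fin 3, c i ≤ z i ∧ z i < c i + ℓ} ∧ ∃ H : Finset (EuclideanSpace ℝ (Fin 3)), H ⊆ F ∧ 1 / 8 * ((F.card : ℝ) - (H.card : ℝ)) + κ * (F.card : ℝ) ≤ ∑ y ∈ H, ((∑' w : ↥Y, Literature.MathematicalPhysics.StatisticalMechanics.lennardJones (dist y (w : EuclideanSpace ℝ (Fin 3)))) - 2 * e)))) → (∃ L t : ℝ, 0 < t ∧ ∀ q ∈ Y, ∀ a : ℝ, 47 / 50 ≤ a → a ≤ 1 → ∃ y ∈ Y, dist y q ≤ L ∧ ¬ ({w ∈ Y | w ≠ y ∧ dist y w < a * (63 / 50) - t}.ncard ≤ 12 ∧ 12 ≤ {w ∈ Y | w ≠ y ∧ dist y w ≤ a * (1 + 1 / 50) + t}.ncard ∧ ∀ w ∈ Y, w ≠ y → a * (1 - 1 / 50) - t ≤ dist y w ∧ (dist y w ≤ a * (1 + 1 / 50) + t ∨ a * (63 / 50) - t ≤ dist y w))) → ¬ (∃ a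 : ℝ, 47 / 50 ≤ a ∧ a ≤ 1 ∧ (∀ y ∈ Y, ({w ∈ Y | w ≠ y ∧ dist y w ≤ a * (1 + 1 / 50)}.ncard = 12 ∧ ∀ w ∈ Y, w ≠ y → a * (1 - 1 / 50) ≤ dist y w ∧ (dist y w ≤ a * (1 + 1 / 50) ∨ a * (63 / 50) ≤ dist y w)) → (∃ T : Finset (EuclideanSpace ℝ (Fin 3)), (↑T : Set (EuclideanSpace ℝ (Fin 3))) = (fun w => a⁻¹ • (w - y)) '' {w ∈ Y | w ≠ y ∧ dist y w ≤ a * (1 + 1 / 50)} ∧ (Literature.Geometry.DiscreteGeometry.ShellCloseTo (1 / 5) T Literature.Geometry.DiscreteGeometry.fccKissingPattern ∨ Literature.Geometry.DiscreteGeometry.ShellCloseTo (1 / 5) T Literature.Geometry.DiscreteGeometry.hcpKissingPattern))) ∧ (∀ z : EuclideanSpace ℝ (Fin 3), ∃ y ∈ Y, ({w ∈ Y | w ≠ y ∧ dist y w ≤ a * (1 + 1 / 50)}.ncard = 12 ∧ ∀ w ∈ Y, w ≠ y → a * (1 - 1 / 50) ≤ dist y w ∧ (dist y w ≤ a * (1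 + 1 / 50) ∨ a * (63 / 50) ≤ dist y w)) ∧ (∃ T : Finset (EuclideanSpace ℝ (Fin 3)), (↑T : Set (EuclideanSpace ℝ (Fin 3))) = (fun w => a⁻¹ • (w - y)) '' {w ∈ Y | w ≠ y ∧ dist y w ≤ a * (1 + 1 / 50)} ∧ (Literature.Geometry.DiscreteGeometry.ShellCloseTo (1 / 5) T Literature.Geometry.DiscreteGeometry.fccKissingPattern ∨ Literature.Geometry.DiscreteGeometry.ShellCloseTo (1 / 5) T Literature.Geometry.DiscreteGeometry.hcpKissingPattern)) ∧ dist z y ≤ r₀)) → (∃ a : ℝ, 47 / 50 ≤ a ∧ a ≤ 1 ∧ ∃ t : ℝ, 0 < t ∧ ∃ y ∈ Y, ({w ∈ Y | w ≠ y ∧ dist y w ≤ a * (1 + 1 / 50) - t}.ncard = 12 ∧ (∀ w ∈ Y, w ≠ y → a * (1 - 1 / 50) + t ≤ dist y w ∧ (dist y w ≤ a * (1 + 1 / 50) - t ∨ a * (63 / 50) + t ≤ dist y w)) ∧ (∃ T : Finset (EuclideanSpace ℝ (Fin 3)), (↑T : Set (EuclideanSpace ℝ (Fin 3))) = (fun w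 => a⁻¹ • (w - y)) '' {w ∈ Y | w ≠ y ∧ dist y w ≤ a * (1 + 1 / 50)} ∧ (Literature.Geometry.DiscreteGeometry.ShellCloseTo (1 / 5 - t) T Literature.Geometry.DiscreteGeometry.fccKissingPattern ∨ Literature.Geometry.DiscreteGeometry.ShellCloseTo (1 / 5 - t) T Literature.Geometry.DiscreteGeometry.hcpKissingPattern)))) → ∃ W : Literature.MathematicalPhysics.StatisticalMechanics.PeriodicConfiguration 3, ∀ R ε : ℝ, 0 < ε → ∃ᶠ N in Filter.atTop, ∃ t : EuclideanSpace ℝ (Fin 3), (∀ s ∈ W.points, ‖s‖ ≤ R → ∃ i : Fin N, dist (x N i + t) s ≤ ε) ∧ (∀ i : Fin N, ‖x N i + t‖ ≤ R → ∃ s ∈ W.points, dist (x N i + t) s ≤ ε)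

/-- `BareOn Y K`: no site of `Y` inside the body `K` is robustly clean Barlow at any admissible spacing (judged in the whole of `Y`; a finite-patch
property of `Y ∩ (K + B(0, 1.3))`). -/
def BareOn (Y K : Set (EuclideanSpace ℝ (Fin 3))) : Prop :=
  ∀ y ∈ Y ∩ K, ∀ a : ℝ, 47 / 50 ≤ a → a ≤ 1 → ∀ t : ℝ, 0 < t → ¬ CleanT a t Y y

/-- **THE LAW · `CleanlessExcess`** (uniform energy gap of Barlow-free bulk; see the module docstring for mechanism, kill criterion and tags). -/
def CleanlessExcess : Prop :=
  ∀ e : ℝ, Filter.Tendsto (fun N : ℕ => Literature.MathematicalPhysics.StatisticalMechanics.groundStateEnergy Literature.MathematicalPhysics.StatisticalMechanics.lennardJones 3 N / N) Filter.atTop (nhds e) → (∀ N : ℕ, 0 < N → e ≤ Literature.MathematicalPhysics.StatisticalMechanics.groundStateEnergy Literature.MathematicalPhysics.StatisticalMechanics.lennardJones 3 N / N) → ∀ δ : ℝ, 0 < δ → ∃ κ : ℝ, 0 < κ ∧ ∃ σ : ℝ, 0 ≤ σ ∧ ∀ Y : Set (EuclideanSpace ℝ (Fin 3)), (∀ p ∈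 Y, ∀ q ∈ Y, p ≠ q → δ ≤ dist p q) → ∀ c : EuclideanSpace ℝ (Fin 3), ∀ R : ℝ, 1 ≤ R → ∀ K : Set (EuclideanSpace ℝ (Fin 3)), Convex ℝ K → Metric.closedBall c (R / 4) ⊆ K → K ⊆ Metric.closedBall c R → BareOn Y K → ∀ S : Finset (EuclideanSpace ℝ (Fin 3)), (↑S : Set (EuclideanSpace ℝ (Fin 3))) = Y ∩ K → (e + κ) * (S.card : ℝ) - σ * R ^ 2 ≤ 1 / 2 * ∑ y ∈ S, ∑ w ∈ S, Literature.MathematicalPhysics.StatisticalMechanics.lennardJones (dist y w)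

/-! ## §B Kernels (no placeholders) -/

/-- **K1 (THE CUT IS EXACT).** `UnhostedResidual r₀ ⟺ CleanlessPiece r₀ ∧ CleanBearingResidual r₀` — excluded middle on `CleanBearing Y`. -/
theorem unhostedResidual_iff_pieces (r₀ : ℝ) : UnhostedResidual r₀ ↔ (CleanlessPiece r₀ ∧ CleanBearingResidual r₀) := by
  unfold UnhostedResidual CleanlessPiece CleanBearingResidual
  constructor
  · intro h
    exact ⟨fun e hT hlb x hx Y h0 hrec hlim hUD hμ hgap hsolid haper hup hlow hacc htwo hthin hrob hnh _ => h e hT hlb x hx Y h0 hrec hlim hUD hμ hgap hsolid haper hup hlow hacc htwo hthin hrob hnh, fun e hT hlb x hx Y h0 hrec hlim hUD hμ hgap hsolid haper hup hlow hacc htwo hthin hrob hnh _ => h e hT hlb x hx Y h0 hrec hlim hUD hμ hgap hsolid haper hup hlow hacc htwo hthin hrob hnh⟩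
  · rintro ⟨h₁, h₂⟩ e hT hlb x hx Y h0 hrec hlim hUD hμ hgap hsolid haper hup hlow hacc htwo hthin hrob hnh
    by_cases hc : CleanBearing Y
    · exact h₂ e hT hlb x hx Y h0 hrec hlim hUD hμ hgap hsolid haper hup hlow hacc htwo hthin hrob hnh hc
    · exact h₁ e hT hlb x hx Y h0 hrec hlim hUD hμ hgap hsolid haper hup hlow hacc htwo hthin hrob hnh hc

/-- **K2 (gen-11 kernel, re-landed over the tree's predicates).** A t-robustly clean site (`t ≥ 0`) is exactly clean and Barlow-close. -/
theorem cleanT_clean {a t : ℝ} (ha : 0 < a) (ht : 0 ≤ t) {Y : Set (EuclideanSpace ℝ (Fin 3))} {y : EuclideanSpace ℝ (Fin 3)}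
    (h : CleanT a t Y y) : GT a Y y ∧ BarlowClose a Y y := by
  obtain ⟨hcard, hgap, T, hT, hclose⟩ := h
  have hset : {w ∈ Y | w ≠ y ∧ dist y w ≤ a * (1 + 1 / 50)} = {w ∈ Y | w ≠ y ∧ dist y w ≤ a * (1 + 1 / 50) - t} := by
    ext w
    simp only [Set.mem_setOf_eq]
    constructor
    · rintro ⟨hw, hne, hd⟩
      refine ⟨hw, hne, ?_⟩
      rcases (hgap w hw hne).2 with h' | h'
      · exact h'
      · exfalso; linarith
    · rintro ⟨hw, hne, hd⟩
      exact ⟨hw, hne, by linarith⟩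
  refine ⟨⟨?_, ?_⟩, ?_⟩
  · rw [hset]; exact hcard
  · intro w hw hne
    obtain ⟨h1, h2⟩ := hgap w hw hne
    refine ⟨by linarith, ?_⟩
    rcases h2 with h2 | h2
    · left; linarith
    · right; linarith
  · refine ⟨T, hT, ?_⟩
    rcases hclose with ⟨A, hA⟩ | ⟨A, hA⟩
    · exact Or.inl ⟨A, hA.mono (by linarith)⟩
    · exact Or.inr ⟨A, hA.mono (by linarith)⟩

/-- **K2b.** The margin of a robustly clean site is at most `a/50` (its window `[0.98a + t, 1.02a − t]` holds twelve sites, so it is nonempty). -/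
theorem margin_le_of_cleanT {a t : ℝ} {Y : Set (EuclideanSpace ℝ (Fin 3))} {y : EuclideanSpace ℝ (Fin 3)}
    (h : CleanT a t Y y) : t ≤ a / 50 := by
  obtain ⟨hcard, hgap, -⟩ := h
  have hne : {w ∈ Y | w ≠ y ∧ dist y w ≤ a * (1 + 1 / 50) - t}.Nonempty := by
    apply Set.nonempty_of_ncard_ne_zero
    rw [hcard]; norm_num
  obtain ⟨w, hw, hwy, hwd⟩ := hne
  have h1 := (hgap w hw hwy).1
  linarith

/-- **K2c.** A Barlow-free texture is bare on every body. -/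
theorem bareOn_of_not_cleanBearing {Y : Set (EuclideanSpace ℝ (Fin 3))} (h : ¬ CleanBearing Y) (K : Set (EuclideanSpace ℝ (Fin 3))) :
    BareOn Y K := by
  intro y hy a ha1 ha2 t ht hc
  exact h ⟨a, ha1, ha2, t, ht, y, hy.1, hc⟩

/-- **K3 (THE MINIMALITY NORMAL FORM · recurrence upgrades one robustly clean Barlow site to a syndetic family).**  In a uniformly discrete,
two-way uniformly recurrent texture of covering radius `< 9/10`, a t-robustly clean Barlow site at an admissible spacing `a` forces, within
bounded distance of EVERY site, a (t/2)-robustly clean Barlow site (landed `cleanT_transport` with base point the clean site itself, patch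
radius `2a`, matching error `ε = min(δ/3, a·t/4)`); with the covering radius, `ThinCores a r Y` for a finite `r`. -/
theorem thinCores_of_cleanT_recurrent {Y : Set (EuclideanSpace ℝ (Fin 3))} (hUD : UniformlyDiscrete Y)
    (hrec : (∀ R ε : ℝ, 0 < ε → ∃ L : ℝ, ∀ p ∈ Y, ∀ q ∈ Y, ∃ q' ∈ Y, dist q' q ≤ L ∧ (∀ y ∈ Y, dist y p ≤ R → ∃ y' ∈ Y, dist (y' - q') (y - p) ≤ ε) ∧ (∀ y' ∈ Y, dist y' q' ≤ R → ∃ y ∈ Y, dist (y' - q') (y - p) ≤ ε)))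
    (hsolid : (∀ z : EuclideanSpace ℝ (Fin 3), ∃ w ∈ Y, dist z w < 9 / 10))
    {a t : ℝ} (ha1 : 47 / 50 ≤ a) (ha2 : a ≤ 1) (ht : 0 < t) {y : EuclideanSpace ℝ (Fin 3)} (hy : y ∈ Y) (hc : CleanT a t Y y) :
    ∃ r : ℝ, ThinCores a r Y ∧ ∀ q ∈ Y, ∃ y' ∈ Y, dist y' q ≤ r ∧ CleanT a (t / 2) Y y' := by
  obtain ⟨δ, hδ, hsep⟩ := id hUD
  have ha : 0 < a := by linarith
  have hta : t ≤ a / 50 := margin_le_of_cleanT hc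
  set ε : ℝ := min (δ / 3) (a * t / 4) with hεdef
  have hεδ3 : ε ≤ δ / 3 := min_le_left _ _
  have hεat : ε ≤ a * t / 4 := min_le_right _ _
  have hat : 0 < a * t := mul_pos ha ht
  have hε : 0 < ε := lt_min (by linarith) (by linarith)
  have hεδ : 2 * ε < δ := by linarith
  have hεt4 : ε ≤ t / 4 := by nlinarith
  have hεa : 100 * ε ≤ a := by nlinarith
  obtain ⟨L, hL⟩ := hrec (2 * a) ε hε
  have key : ∀ q ∈ Y, ∃ y' ∈ Y, dist y' q ≤ L + 1 ∧ CleanT a (t / 2) Y y' := by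
    intro q hq
    obtain ⟨q', hq', hdq, hex₁, hex₂⟩ := hL y hy q hq
    obtain ⟨y', hy', hyy'⟩ := hex₁ y hy (by rw [dist_self]; positivity)
    have hd' : dist y' q' ≤ ε := by
      have h0 : y - y = 0 := sub_self y
      rw [h0, dist_zero_right, ← dist_eq_norm] at hyy'
      exact hyy'
    refine ⟨y', hy', ?_, ?_⟩
    · have := dist_triangle y' q' q
      have hε1 : ε ≤ 1 := by nlinarith
      linarith
    · exact cleanT_transport hsep hε.le hεδ hex₁ hex₂ ha hεa (by linarith) hta (by linarith) (by nlinarith) hy hy' hyy'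
        (by rw [dist_self]; linarith) (Or.inl (by linarith)) hc
  refine ⟨L + 2, ?_, fun q hq => ?_⟩
  · intro z
    obtain ⟨q, hq, hzq⟩ := hsolid z
    obtain ⟨y', hy', hd, hc'⟩ := key q hq
    obtain ⟨hg, hb⟩ := cleanT_clean ha (by linarith) hc'
    refine ⟨y', hy', hg, hb, ?_⟩
    have := dist_triangle z q y'
    rw [dist_comm q y'] at this
    linarith
  · obtain ⟨y', hy', hd, hc'⟩ := key q hq
    exact ⟨y', hy', by linarith, hc'⟩

/-- **K4 (the law feeds the transfer lemma).**  `CleanlessExcess` gives the per-particle floor on every coordinate cube of side `ℓ ≥ 1` of a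
δ-separated texture that is bare on every body (cube = convex body with `B̄(ℓ/4) ⊆ Q ⊆ B̄(ℓ)` about its centre, WallTensionLever K2a–c). -/
theorem cubeFloor_of_cleanlessExcess (hCE : CleanlessExcess) :
    ∀ e : ℝ, Filter.Tendsto (fun N : ℕ => Literature.MathematicalPhysics.StatisticalMechanics.groundStateEnergy Literature.MathematicalPhysics.StatisticalMechanics.lennardJones 3 N / N) Filter.atTop (nhds e) → (∀ N : ℕ, 0 < N → e ≤ Literature.MathematicalPhysics.StatisticalMechanics.groundStateEnergy Literature.MathematicalPhysics.StatisticalMechanics.lennardJones 3 N / N) → ∀ δ : ℝ, 0 < δ → ∃ κ : ℝ, 0 < κ ∧ ∃ σ : ℝ, 0 ≤ σ ∧ ∀ Y : Set (EuclideanSpace ℝ (Fin 3)), (∀ p ∈ Y, ∀ q ∈ Y, p ≠ q → δ ≤ dist p q) → (∀ K : Set (EuclideanSpace ℝ (Fin 3)), BareOn Y K) → ∀ c : EuclideanSpace ℝ (Fin 3), ∀ ℓ : ℝ, 1 ≤ ℓ → ∀ F : Finset (EuclideanSpace ℝ (Fin 3)), (↑F : Set (EuclideanSpace ℝ (Fin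 3))) = Y ∩ {z | ∀ i : Fin 3, c i ≤ z i ∧ z i < c i + ℓ} → (e + κ) * (F.card : ℝ) - σ * ℓ ^ 2 ≤ 1 / 2 * ∑ y ∈ F, ∑ w ∈ F, Literature.MathematicalPhysics.StatisticalMechanics.lennardJones (dist y w) := by
  intro e hT hLB δ hδ
  obtain ⟨κ, hκ, σ, hσ, hfloor⟩ := hCE e hT hLB δ hδ
  refine ⟨κ, hκ, σ, hσ, fun Y hsep hbare c ℓ hℓ F hF => ?_⟩
  have hℓpos : 0 < ℓ := by linarith
  exact hfloor Y hsep (c + WithLp.toLp 2 (fun _ : Fin 3 => ℓ / 2)) ℓ hℓ {z | ∀ i : Fin 3, c i ≤ z i ∧ z i < c i + ℓ}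
    (cube_convex c ℓ) (by simpa using closedBall_subset_cube c hℓpos) (cube_subset_closedBall c hℓpos.le) (hbare _) F hF

/-- **K5 (THE DOOR SIDE IS VACUOUS GIVEN THE LAW).**  `CleanlessExcess ⟹ CleanlessPiece r₀` for every `r₀`: a Barlow-free texture is bare on
every cube (K2c); the law gives the per-particle floor on all cubes of side ≥ 1 (K4); the landed transfer lemma `cubeCharge_of_cubeFloor` turns
it into site charge `> (κ/16)ℓ³` on every cube of large even side; the landed `cubeChargeLaw` (μ-stability, stmt-30251) bounds the same charge by
`(κ/16)ℓ³` in absolute value — contradiction.  Of RDEF's twenty hypotheses only LB, uniform discreteness, μ-stability and the covering radius are used. -/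
theorem cleanlessPiece_of_cleanlessExcess (r₀ : ℝ) (hCE : CleanlessExcess) : CleanlessPiece r₀ := by
  unfold CleanlessPiece
  intro e hT hlb x hx Y h0 hrec hlim hUD hμ hgap hsolid haper hup hlow hacc htwo hthin hrob _hnh hnc
  exfalso
  classical
  obtain ⟨δ, hδ, hsep⟩ := id hUD
  obtain ⟨κ, hκ, σ, -, hfloor⟩ := cubeFloor_of_cleanlessExcess hCE e hT hlb δ hδ
  have hbare : ∀ K : Set (EuclideanSpace ℝ (Fin 3)), BareOn Y K := bareOn_of_not_cleanBearing hnc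
  obtain ⟨n₀, hbig⟩ := cubeCharge_of_cubeFloor hUD hsolid hκ (hfloor Y hsep hbare)
  have hcube := cubeChargeLaw
  unfold CubeChargeLaw at hcube
  obtain ⟨ℓ₀, hℓ₀⟩ := hcube e hlb Y hUD hμ (κ / 16) (by positivity)
  obtain ⟨n, hn⟩ := exists_nat_ge (max ℓ₀ (n₀ : ℝ))
  have hnn₀ : n₀ ≤ n := by exact_mod_cast (le_max_right ℓ₀ (n₀ : ℝ)).trans hn
  have hn0 : (0 : ℝ) ≤ n := Nat.cast_nonneg n
  have hℓ : ℓ₀ ≤ (n : ℝ) * 2 := by linarith [le_max_left ℓ₀ (n₀ : ℝ)]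
  have hfin := finite_inter_cube hUD (0 : EuclideanSpace ℝ (Fin 3)) (by positivity : (0 : ℝ) ≤ (n : ℝ) * 2)
  have h1 := hbig n hnn₀ 0 hfin.toFinset hfin.coe_toFinset
  have h2 := hℓ₀ ((n : ℝ) * 2) 0 hℓ hfin.toFinset hfin.coe_toFinset
  exact absurd (lt_of_lt_of_le h1 (le_abs_self _)) (not_lt.mpr h2)

/-- **K6 (composition at node level).**  Law ∧ clean-bearing residual ⟹ the registered residual. -/
theorem unhostedResidual_of_law_residual {r₀ : ℝ} (hCE : CleanlessExcess) (hR : CleanBearingResidual r₀) : UnhostedResidual r₀ :=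
  (unhostedResidual_iff_pieces r₀).2 ⟨cleanlessPiece_of_cleanlessExcess r₀ hCE, hR⟩

/-- **K7 (lineage chain, generation-14 kernel K9 verbatim).**  RDEF (the crux, BY NAME) ⟺ HostedTarget r₀ ∧ UnhostedResidual r₀. -/
theorem rdef_iff_hosted_unhosted (r₀ : ℝ) : RobustDefectLimitWindows ↔ (HostedTarget r₀ ∧ UnhostedResidual r₀) := by
  unfold RobustDefectLimitWindows HostedTarget UnhostedResidual
  constructor
  · intro h
    exact ⟨fun e hT hlb x hx Y h0 hrec hlim hUD hμ hgap hsolid haper hup hlow hacc htwo hthin hrob _ => h e hT hlb x hx Y h0 hrec hlim hUD hμ hgap hsolid haper hup hlow hacc htwo hthin hrob, fun e hT hlb x hx Y h0 hrec hlim hUD hμ hgap hsolid haper hup hlow hacc htwo hthin hrob _ => h e hT hlb x hx Y h0 hrec hlim hUD hμ hgap hsolid haper hup hlow hacc htwo hthin hrob⟩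
  · rintro ⟨h₁, h₂⟩ e hT hlb x hx Y h0 hrec hlim hUD hμ hgap hsolid haper hup hlow hacc htwo hthin hrob
    by_cases hh : Hosted r₀ Y
    · exact h₁ e hT hlb x hx Y h0 hrec hlim hUD hμ hgap hsolid haper hup hlow hacc htwo hthin hrob hh
    · exact h₂ e hT hlb x hx Y h0 hrec hlim hUD hμ hgap hsolid haper hup hlow hacc htwo hthin hrob hh

/-- **K7′.**  RDEF ⟺ HostedTarget r₀ ∧ CleanlessPiece r₀ ∧ CleanBearingResidual r₀; with the law, RDEF ⟸ HostedTarget r₀ ∧ CleanBearingResidual r₀. -/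
theorem rdef_iff_three (r₀ : ℝ) : RobustDefectLimitWindows ↔ (HostedTarget r₀ ∧ CleanlessPiece r₀ ∧ CleanBearingResidual r₀) := by
  rw [rdef_iff_hosted_unhosted r₀, unhostedResidual_iff_pieces r₀]

/-- **K7″.** Hosted target ∧ law ∧ clean-bearing residual ⟹ the crux (by name). -/
theorem rdef_of_hosted_law_residual {r₀ : ℝ} (hH : HostedTarget r₀) (hCE : CleanlessExcess) (hR : CleanBearingResidual r₀) :
    RobustDefectLimitWindows :=
  (rdef_iff_hosted_unhosted r₀).2 ⟨hH, unhostedResidual_of_law_residual hCE hR⟩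

/-- **K8 (sanity: the pieces are RESTRICTIONS of the crux — never stronger than the item they cut).** -/
theorem cleanBearingResidual_of_rdef (r₀ : ℝ) (h : RobustDefectLimitWindows) : CleanBearingResidual r₀ :=
  ((rdef_iff_three r₀).1 h).2.2

/-- **K8′.** The door-side piece is a restriction of the crux. -/
theorem cleanlessPiece_of_rdef (r₀ : ℝ) (h : RobustDefectLimitWindows) : CleanlessPiece r₀ :=
  ((rdef_iff_three r₀).1 h).2.1

/-- **K8″.** The registered residual is a restriction of the crux. -/
theorem unhostedResidual_of_rdef (r₀ : ℝ) (h : RobustDefectLimitWindows) : UnhostedResidual r₀ :=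
  ((rdef_iff_hosted_unhosted r₀).1 h).2

/-- **K8b (dial monotonicity).** A larger core radius makes more textures hosted: the residuals are monotone (weaker) in `r₀`. -/
theorem hosted_mono {r r' : ℝ} (h : r ≤ r') {Y : Set (EuclideanSpace ℝ (Fin 3))} (hY : Hosted r Y) : Hosted r' Y := by
  obtain ⟨a, ha1, ha2, hmat, hthin⟩ := hY
  refine ⟨a, ha1, ha2, hmat, fun z => ?_⟩
  obtain ⟨y, hy, hg, hb, hd⟩ := hthin z
  exact ⟨y, hy, hg, hb, hd.trans h⟩

/-- **K8c.** The clean-bearing residual is monotone (weaker) in the core radius. -/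
theorem cleanBearingResidual_mono {r r' : ℝ} (h : r ≤ r') (hR : CleanBearingResidual r) : CleanBearingResidual r' := by
  unfold CleanBearingResidual at hR ⊢
  intro e hT hlb x hx Y h0 hrec hlim hUD hμ hgap hsolid haper hup hlow hacc htwo hthin hrob hnh hc
  exact hR e hT hlb x hx Y h0 hrec hlim hUD hμ hgap hsolid haper hup hlow hacc htwo hthin hrob (fun hh => hnh (hosted_mono h hh)) hc

/-- **K9 (THE RESIDUAL WORLD HAS FINITE DEPTH).**  Under RDEF's standing hypotheses (uniform discreteness, two-way recurrence, covering radius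
< 9/10), a clean-bearing texture has, at its clean-bearing spacing `a`, clean Barlow sites within a finite distance `r` of every point; if it is
moreover unhosted at `r₀`, then at that spacing it is TORN (¬MAT) or `r₀ < r` is forced (its cores are thicker than `r₀` somewhere). -/
theorem finiteDepth_of_cleanBearing {Y : Set (EuclideanSpace ℝ (Fin 3))} (hUD : UniformlyDiscrete Y)
    (hrec : (∀ R ε : ℝ, 0 < ε → ∃ L : ℝ, ∀ p ∈ Y, ∀ q ∈ Y, ∃ q' ∈ Y, dist q' q ≤ L ∧ (∀ y ∈ Y, dist y p ≤ R → ∃ y' ∈ Y, dist (y' - q') (y - p) ≤ ε) ∧ (∀ y' ∈ Y, dist y' q' ≤ R → ∃ y ∈ Y, dist (y' - q') (y - p) ≤ ε)))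
    (hsolid : (∀ z : EuclideanSpace ℝ (Fin 3), ∃ w ∈ Y, dist z w < 9 / 10))
    (h : CleanBearing Y) : ∃ a : ℝ, 47 / 50 ≤ a ∧ a ≤ 1 ∧ (∃ t : ℝ, 0 < t ∧ ∃ y ∈ Y, CleanT a t Y y) ∧ ∃ r : ℝ, ThinCores a r Y := by
  obtain ⟨a, ha1, ha2, t, ht, y, hy, hc⟩ := h
  obtain ⟨r, hr, -⟩ := thinCores_of_cleanT_recurrent hUD hrec hsolid ha1 ha2 ht hy hc
  exact ⟨a, ha1, ha2, ⟨t, ht, y, hy, hc⟩, r, hr⟩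

/-- **K9′.** An unhosted texture with r-dense clean Barlow sites at an admissible spacing is torn there (¬MAT) or has a core thicker than `r₀ < r`. -/
theorem torn_or_thick_of_unhosted {r₀ : ℝ} {Y : Set (EuclideanSpace ℝ (Fin 3))} (hnh : ¬ Hosted r₀ Y) {a : ℝ} (ha1 : 47 / 50 ≤ a) (ha2 : a ≤ 1)
    {r : ℝ} (hr : ThinCores a r Y) : ¬ MAT a Y ∨ (¬ ThinCores a r₀ Y ∧ r₀ < r) := by
  by_cases hm : MAT a Y
  · right
    have hnt : ¬ ThinCores a r₀ Y := fun ht => hnh ⟨a, ha1, ha2, hm, ht⟩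
    refine ⟨hnt, ?_⟩
    by_contra hle
    rw [not_lt] at hle
    exact hnt (fun z => by
      obtain ⟨y, hy, hg, hb, hd⟩ := hr z
      exact ⟨y, hy, hg, hb, hd.trans hle⟩)
  · exact Or.inl hm

/-! ## §E Pins (`Iff.rfl`) — the readable predicates ARE the lineage texts -/

/-- PIN · at `r₀ = 10` the residual is, literally, the registered stub `stub_unhostedResidual` of line v7 «HostedDustCut»
(`decomp-a2c-lens-4/g14/bc/line-hosteddust-v7.lean`, skeleton 624a0fa0…): a proof `h : CleanlessExcess`, `h' : CleanBearingResidual 10` closes that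
stub by `unhostedResidual_ten_iff.1 (unhostedResidual_of_law_residual h h')`. -/
theorem unhostedResidual_ten_iff : UnhostedResidual 10 ↔ (∀ e : ℝ, Filter.Tendsto (fun N : ℕ => Literature.MathematicalPhysics.StatisticalMechanics.groundStateEnergy Literature.MathematicalPhysics.StatisticalMechanics.lennardJones 3 N / N) Filter.atTop (nhds e) → (∀ N : ℕ, 0 < N → e ≤ Literature.MathematicalPhysics.StatisticalMechanics.groundStateEnergy Literature.MathematicalPhysics.StatisticalMechanics.lennardJones 3 N / N) → ∀ x : (N : ℕ) → (Fin N → EuclideanSpace ℝ (Fin 3)), (∀ N, Literature.MathematicalPhysics.StatisticalMechanics.IsGroundState Literature.MathematicalPhysics.StatisticalMechanics.lennardJones (x N)) → ∀ Y : Set (EuclideanSpace ℝ (Fin 3)), (0 : EuclideanSpace ℝ (Fin 3)) ∈ Y → (∀ R ε : ℝ, 0 < ε → ∃ L : ℝ, ∀ p ∈ Y, ∀ q ∈ Y, ∃ q' ∈ Y, dist q' q ≤ L ∧ (∀ y ∈ Y, dist y p ≤ R → ∃ y' ∈ Y, dist (y' - q') (y - p) ≤ ε) ∧ (∀ y' ∈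 Y, dist y' q' ≤ R → ∃ y ∈ Y, dist (y' - q') (y - p) ≤ ε)) → (∃ (φ : ℕ → ℕ) (t : ℕ → EuclideanSpace ℝ (Fin 3)), StrictMono φ ∧ ∀ R ε : ℝ, 0 < ε → ∀ᶠ n in Filter.atTop, (∀ y ∈ Y, ‖y‖ ≤ R → ∃ i : Fin (φ n), dist (x (φ n) i + t n) y ≤ ε) ∧ (∀ i : Fin (φ n), ‖x (φ n) i + t n‖ ≤ R → ∃ y ∈ Y, dist (x (φ n) i + t n) y ≤ ε)) → Literature.MathematicalPhysics.StatisticalMechanics.UniformlyDiscrete Y → Literature.MathematicalPhysics.StatisticalMechanics.IsMuGSC Literature.MathematicalPhysics.StatisticalMechanics.lennardJones e Y → (¬ (∃ a : ℝ, 47 / 50 ≤ a ∧ a ≤ 1 ∧ ∀ y ∈ Y, ({w ∈ Y | w ≠ y ∧ dist y w ≤ a * (1 + 1 / 50)}.ncard = 12 ∧ ∀ w ∈ Y, w ≠ y → a * (1 - 1 / 50) ≤ dist y w ∧ (dist y w ≤ a * (1 + 1 / 50) ∨ a * (63 / 50) ≤ dist y w)))) → (∀ z : EuclideanSpace ℝ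 (Fin 3), ∃ w ∈ Y, dist z w < 9 / 10) → (¬ (∃ W : Literature.MathematicalPhysics.StatisticalMechanics.PeriodicConfiguration 3, W.points = Y)) → (∃ ℓ₀ : ℝ, ∀ ℓ : ℝ, ∀ c : EuclideanSpace ℝ (Fin 3), ℓ₀ ≤ ℓ → ((Y ∩ {z | ∀ i : Fin 3, c i ≤ z i ∧ z i < c i + ℓ}).ncard : ℝ) < 2 * ℓ ^ 3) → (∃ ℓ₀ : ℝ, ∀ ℓ : ℝ, ∀ c : EuclideanSpace ℝ (Fin 3), ℓ₀ ≤ ℓ → 5 / 4 * ℓ ^ 3 < ((Y ∩ {z | ∀ i : Fin 3, c i ≤ z i ∧ z i < c i + ℓ}).ncard : ℝ)) → (¬ (∃ a : ℝ, 47 / 50 ≤ a ∧ a ≤ 1 ∧ ∃ K : ℝ, 0 < K ∧ ∃ c : EuclideanSpace ℝ (Fin 3), (∃ y ∈ Y, dist y c ≤ K ∧ ¬ (({v ∈ Y | v ≠ y ∧ dist y v ≤ a * (1 + 1 / 10)}.ncard = 12 ∧ ∀ v ∈ Y, v ≠ y → a * (1 - 1 / 10) ≤ dist y v ∧ (dist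 y v ≤ a * (1 + 1 / 10) ∨ a * (63 / 50) ≤ dist y v)) ∧ (∃ T : Finset (EuclideanSpace ℝ (Fin 3)), (↑T : Set (EuclideanSpace ℝ (Fin 3))) = (fun v => a⁻¹ • (v - y)) '' {v ∈ Y | v ≠ y ∧ dist y v ≤ a * (1 + 1 / 10)} ∧ (Literature.Geometry.DiscreteGeometry.ShellCloseTo (2 / 5) T Literature.Geometry.DiscreteGeometry.fccKissingPattern ∨ Literature.Geometry.DiscreteGeometry.ShellCloseTo (2 / 5) T Literature.Geometry.DiscreteGeometry.hcpKissingPattern)))) ∧ (∀ w ∈ Y, K < dist w c → dist w c ≤ 4 * K + 6 → (({v ∈ Y | v ≠ w ∧ dist w v ≤ a * (1 + 1 / 50)}.ncard = 12 ∧ ∀ v ∈ Y, v ≠ w → a * (1 - 1 / 50) ≤ dist w v ∧ (dist w v ≤ a * (1 + 1 / 50) ∨ a * (63 / 50) ≤ dist w v)) ∧ (∃ T : Finset (EuclideanSpace ℝ (Fin 3)), (↑T : Set (EuclideanSpace ℝ (Fin 3))) = (fun v => a⁻¹ • (v - w)) '' {v ∈ Y | v ≠ w ∧ dist w v ≤ a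 * (1 + 1 / 50)} ∧ (Literature.Geometry.DiscreteGeometry.ShellCloseTo (1 / 5) T Literature.Geometry.DiscreteGeometry.fccKissingPattern ∨ Literature.Geometry.DiscreteGeometry.ShellCloseTo (1 / 5) T Literature.Geometry.DiscreteGeometry.hcpKissingPattern)))))) → ((∃ y ∈ Y, (∑' w : ↥Y, Literature.MathematicalPhysics.StatisticalMechanics.lennardJones (dist y (w : EuclideanSpace ℝ (Fin 3)))) < 2 * e) ∧ (∃ y ∈ Y, 2 * e < (∑' w : ↥Y, Literature.MathematicalPhysics.StatisticalMechanics.lennardJones (dist y (w : EuclideanSpace ℝ (Fin 3)))))) → (¬ (∃ κ : ℝ, 0 < κ ∧ (∀ ℓ₀ : ℝ, ∃ ℓ : ℝ, ℓ₀ ≤ ℓ ∧ ∃ c : EuclideanSpace ℝ (Fin 3), ∃ F : Finset (EuclideanSpace ℝ (Fin 3)), (↑F : Set (EuclideanSpace ℝ (Fin 3))) = Y ∩ {z | ∀ i : Fin 3, c i ≤ z i ∧ z i < c i + ℓ} ∧ ∃ H : Finset (EuclideanSpace ℝ (Fin 3)), H ⊆ F ∧ 1 / 8 * ((F.card : ℝ)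 - (H.card : ℝ)) + κ * (F.card : ℝ) ≤ ∑ y ∈ H, ((∑' w : ↥Y, Literature.MathematicalPhysics.StatisticalMechanics.lennardJones (dist y (w : EuclideanSpace ℝ (Fin 3)))) - 2 * e)))) → (∃ L t : ℝ, 0 < t ∧ ∀ q ∈ Y, ∀ a : ℝ, 47 / 50 ≤ a → a ≤ 1 → ∃ y ∈ Y, dist y q ≤ L ∧ ¬ ({w ∈ Y | w ≠ y ∧ dist y w < a * (63 / 50) - t}.ncard ≤ 12 ∧ 12 ≤ {w ∈ Y | w ≠ y ∧ dist y w ≤ a * (1 + 1 / 50) + t}.ncard ∧ ∀ w ∈ Y, w ≠ y → a * (1 - 1 / 50) - t ≤ dist y w ∧ (dist y w ≤ a * (1 + 1 / 50) + t ∨ a * (63 / 50) - t ≤ dist y w))) → ¬ (∃ a : ℝ, 47 / 50 ≤ a ∧ a ≤ 1 ∧ (∀ y ∈ Y, ({w ∈ Y | w ≠ y ∧ dist y w ≤ a * (1 + 1 / 50)}.ncard = 12 ∧ ∀ w ∈ Y, w ≠ y → a * (1 - 1 / 50) ≤ dist y w ∧ (dist y w ≤ a * (1 + 1 / 50) ∨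 a * (63 / 50) ≤ dist y w)) → (∃ T : Finset (EuclideanSpace ℝ (Fin 3)), (↑T : Set (EuclideanSpace ℝ (Fin 3))) = (fun w => a⁻¹ • (w - y)) '' {w ∈ Y | w ≠ y ∧ dist y w ≤ a * (1 + 1 / 50)} ∧ (Literature.Geometry.DiscreteGeometry.ShellCloseTo (1 / 5) T Literature.Geometry.DiscreteGeometry.fccKissingPattern ∨ Literature.Geometry.DiscreteGeometry.ShellCloseTo (1 / 5) T Literature.Geometry.DiscreteGeometry.hcpKissingPattern))) ∧ (∀ z : EuclideanSpace ℝ (Fin 3), ∃ y ∈ Y, ({w ∈ Y | w ≠ y ∧ dist y w ≤ a * (1 + 1 / 50)}.ncard = 12 ∧ ∀ w ∈ Y, w ≠ y → a * (1 - 1 / 50) ≤ dist y w ∧ (dist y w ≤ a * (1 + 1 / 50) ∨ a * (63 / 50) ≤ dist y w)) ∧ (∃ T : Finset (EuclideanSpace ℝ (Fin 3)), (↑T : Set (EuclideanSpace ℝ (Fin 3))) = (fun w => a⁻¹ • (w - y)) '' {w ∈ Y | w ≠ y ∧ dist y w ≤ a * (1 + 1 / 50)} ∧ (Literature.Geometry.DiscreteGeometry.ShellCloseTo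 (1 / 5) T Literature.Geometry.DiscreteGeometry.fccKissingPattern ∨ Literature.Geometry.DiscreteGeometry.ShellCloseTo (1 / 5) T Literature.Geometry.DiscreteGeometry.hcpKissingPattern)) ∧ dist z y ≤ 10)) → ∃ W : Literature.MathematicalPhysics.StatisticalMechanics.PeriodicConfiguration 3, ∀ R ε : ℝ, 0 < ε → ∃ᶠ N in Filter.atTop, ∃ t : EuclideanSpace ℝ (Fin 3), (∀ s ∈ W.points, ‖s‖ ≤ R → ∃ i : Fin N, dist (x N i + t) s ≤ ε) ∧ (∀ i : Fin N, ‖x N i + t‖ ≤ R → ∃ s ∈ W.points, dist (x N i + t) s ≤ ε)) :=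
  Iff.rfl

/-- PIN · the door-side piece at `r₀ = 10`, fully expanded. -/
theorem cleanlessPiece_ten_iff : CleanlessPiece 10 ↔ (∀ e : ℝ, Filter.Tendsto (fun N : ℕ => Literature.MathematicalPhysics.StatisticalMechanics.groundStateEnergy Literature.MathematicalPhysics.StatisticalMechanics.lennardJones 3 N / N) Filter.atTop (nhds e) → (∀ N : ℕ, 0 < N → e ≤ Literature.MathematicalPhysics.StatisticalMechanics.groundStateEnergy Literature.MathematicalPhysics.StatisticalMechanics.lennardJones 3 N / N) → ∀ x : (N : ℕ) → (Fin N → EuclideanSpace ℝ (Fin 3)), (∀ N, Literature.MathematicalPhysics.StatisticalMechanics.IsGroundState Literature.MathematicalPhysics.StatisticalMechanics.lennardJones (x N)) → ∀ Y : Set (EuclideanSpace ℝ (Fin 3)), (0 : EuclideanSpace ℝ (Fin 3)) ∈ Y → (∀ R ε : ℝ, 0 < ε → ∃ L : ℝ, ∀ p ∈ Y, ∀ q ∈ Y, ∃ q' ∈ Y, dist q' q ≤ L ∧ (∀ y ∈ Y, dist y p ≤ R → ∃ y' ∈ Y, dist (y' - q') (y - p) ≤ ε) ∧ (∀ y' ∈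 Y, dist y' q' ≤ R → ∃ y ∈ Y, dist (y' - q') (y - p) ≤ ε)) → (∃ (φ : ℕ → ℕ) (t : ℕ → EuclideanSpace ℝ (Fin 3)), StrictMono φ ∧ ∀ R ε : ℝ, 0 < ε → ∀ᶠ n in Filter.atTop, (∀ y ∈ Y, ‖y‖ ≤ R → ∃ i : Fin (φ n), dist (x (φ n) i + t n) y ≤ ε) ∧ (∀ i : Fin (φ n), ‖x (φ n) i + t n‖ ≤ R → ∃ y ∈ Y, dist (x (φ n) i + t n) y ≤ ε)) → Literature.MathematicalPhysics.StatisticalMechanics.UniformlyDiscrete Y → Literature.MathematicalPhysics.StatisticalMechanics.IsMuGSC Literature.MathematicalPhysics.StatisticalMechanics.lennardJones e Y → (¬ (∃ a : ℝ, 47 / 50 ≤ a ∧ a ≤ 1 ∧ ∀ y ∈ Y, ({w ∈ Y | w ≠ y ∧ dist y w ≤ a * (1 + 1 / 50)}.ncard = 12 ∧ ∀ w ∈ Y, w ≠ y → a * (1 - 1 / 50) ≤ dist y w ∧ (dist y w ≤ a * (1 + 1 / 50) ∨ a * (63 / 50) ≤ dist y w)))) → (∀ z : EuclideanSpace ℝ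 (Fin 3), ∃ w ∈ Y, dist z w < 9 / 10) → (¬ (∃ W : Literature.MathematicalPhysics.StatisticalMechanics.PeriodicConfiguration 3, W.points = Y)) → (∃ ℓ₀ : ℝ, ∀ ℓ : ℝ, ∀ c : EuclideanSpace ℝ (Fin 3), ℓ₀ ≤ ℓ → ((Y ∩ {z | ∀ i : Fin 3, c i ≤ z i ∧ z i < c i + ℓ}).ncard : ℝ) < 2 * ℓ ^ 3) → (∃ ℓ₀ : ℝ, ∀ ℓ : ℝ, ∀ c : EuclideanSpace ℝ (Fin 3), ℓ₀ ≤ ℓ → 5 / 4 * ℓ ^ 3 < ((Y ∩ {z | ∀ i : Fin 3, c i ≤ z i ∧ z i < c i + ℓ}).ncard : ℝ)) → (¬ (∃ a : ℝ, 47 / 50 ≤ a ∧ a ≤ 1 ∧ ∃ K : ℝ, 0 < K ∧ ∃ c : EuclideanSpace ℝ (Fin 3), (∃ y ∈ Y, dist y c ≤ K ∧ ¬ (({v ∈ Y | v ≠ y ∧ dist y v ≤ a * (1 + 1 / 10)}.ncard = 12 ∧ ∀ v ∈ Y, v ≠ y → a * (1 - 1 / 10) ≤ dist y v ∧ (dist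 y v ≤ a * (1 + 1 / 10) ∨ a * (63 / 50) ≤ dist y v)) ∧ (∃ T : Finset (EuclideanSpace ℝ (Fin 3)), (↑T : Set (EuclideanSpace ℝ (Fin 3))) = (fun v => a⁻¹ • (v - y)) '' {v ∈ Y | v ≠ y ∧ dist y v ≤ a * (1 + 1 / 10)} ∧ (Literature.Geometry.DiscreteGeometry.ShellCloseTo (2 / 5) T Literature.Geometry.DiscreteGeometry.fccKissingPattern ∨ Literature.Geometry.DiscreteGeometry.ShellCloseTo (2 / 5) T Literature.Geometry.DiscreteGeometry.hcpKissingPattern)))) ∧ (∀ w ∈ Y, K < dist w c → dist w c ≤ 4 * K + 6 → (({v ∈ Y | v ≠ w ∧ dist w v ≤ a * (1 + 1 / 50)}.ncard = 12 ∧ ∀ v ∈ Y, v ≠ w → a * (1 - 1 / 50) ≤ dist w v ∧ (dist w v ≤ a * (1 + 1 / 50) ∨ a * (63 / 50) ≤ dist w v)) ∧ (∃ T : Finset (EuclideanSpace ℝ (Fin 3)), (↑T : Set (EuclideanSpace ℝ (Fin 3))) = (fun v => a⁻¹ • (v - w)) '' {v ∈ Y | v ≠ w ∧ dist w v ≤ a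 * (1 + 1 / 50)} ∧ (Literature.Geometry.DiscreteGeometry.ShellCloseTo (1 / 5) T Literature.Geometry.DiscreteGeometry.fccKissingPattern ∨ Literature.Geometry.DiscreteGeometry.ShellCloseTo (1 / 5) T Literature.Geometry.DiscreteGeometry.hcpKissingPattern)))))) → ((∃ y ∈ Y, (∑' w : ↥Y, Literature.MathematicalPhysics.StatisticalMechanics.lennardJones (dist y (w : EuclideanSpace ℝ (Fin 3)))) < 2 * e) ∧ (∃ y ∈ Y, 2 * e < (∑' w : ↥Y, Literature.MathematicalPhysics.StatisticalMechanics.lennardJones (dist y (w : EuclideanSpace ℝ (Fin 3)))))) → (¬ (∃ κ : ℝ, 0 < κ ∧ (∀ ℓ₀ : ℝ, ∃ ℓ : ℝ, ℓ₀ ≤ ℓ ∧ ∃ c : EuclideanSpace ℝ (Fin 3), ∃ F : Finset (EuclideanSpace ℝ (Fin 3)), (↑F : Set (EuclideanSpace ℝ (Fin 3))) = Y ∩ {z | ∀ i : Fin 3, c i ≤ z i ∧ z i < c i + ℓ} ∧ ∃ H : Finset (EuclideanSpace ℝ (Fin 3)), H ⊆ F ∧ 1 / 8 * ((F.card : ℝ)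 - (H.card : ℝ)) + κ * (F.card : ℝ) ≤ ∑ y ∈ H, ((∑' w : ↥Y, Literature.MathematicalPhysics.StatisticalMechanics.lennardJones (dist y (w : EuclideanSpace ℝ (Fin 3)))) - 2 * e)))) → (∃ L t : ℝ, 0 < t ∧ ∀ q ∈ Y, ∀ a : ℝ, 47 / 50 ≤ a → a ≤ 1 → ∃ y ∈ Y, dist y q ≤ L ∧ ¬ ({w ∈ Y | w ≠ y ∧ dist y w < a * (63 / 50) - t}.ncard ≤ 12 ∧ 12 ≤ {w ∈ Y | w ≠ y ∧ dist y w ≤ a * (1 + 1 / 50) + t}.ncard ∧ ∀ w ∈ Y, w ≠ y → a * (1 - 1 / 50) - t ≤ dist y w ∧ (dist y w ≤ a * (1 + 1 / 50) + t ∨ a * (63 / 50) - t ≤ dist y w))) → ¬ (∃ a : ℝ, 47 / 50 ≤ a ∧ a ≤ 1 ∧ (∀ y ∈ Y, ({w ∈ Y | w ≠ y ∧ dist y w ≤ a * (1 + 1 / 50)}.ncard = 12 ∧ ∀ w ∈ Y, w ≠ y → a * (1 - 1 / 50) ≤ dist y w ∧ (dist y w ≤ a * (1 + 1 / 50) ∨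 a * (63 / 50) ≤ dist y w)) → (∃ T : Finset (EuclideanSpace ℝ (Fin 3)), (↑T : Set (EuclideanSpace ℝ (Fin 3))) = (fun w => a⁻¹ • (w - y)) '' {w ∈ Y | w ≠ y ∧ dist y w ≤ a * (1 + 1 / 50)} ∧ (Literature.Geometry.DiscreteGeometry.ShellCloseTo (1 / 5) T Literature.Geometry.DiscreteGeometry.fccKissingPattern ∨ Literature.Geometry.DiscreteGeometry.ShellCloseTo (1 / 5) T Literature.Geometry.DiscreteGeometry.hcpKissingPattern))) ∧ (∀ z : EuclideanSpace ℝ (Fin 3), ∃ y ∈ Y, ({w ∈ Y | w ≠ y ∧ dist y w ≤ a * (1 + 1 / 50)}.ncard = 12 ∧ ∀ w ∈ Y, w ≠ y → a * (1 - 1 / 50) ≤ dist y w ∧ (dist y w ≤ a * (1 + 1 / 50) ∨ a * (63 / 50) ≤ dist y w)) ∧ (∃ T : Finset (EuclideanSpace ℝ (Fin 3)), (↑T : Set (EuclideanSpace ℝ (Fin 3))) = (fun w => a⁻¹ • (w - y)) '' {w ∈ Y | w ≠ y ∧ dist y w ≤ a * (1 + 1 / 50)} ∧ (Literature.Geometry.DiscreteGeometry.ShellCloseTo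 (1 / 5) T Literature.Geometry.DiscreteGeometry.fccKissingPattern ∨ Literature.Geometry.DiscreteGeometry.ShellCloseTo (1 / 5) T Literature.Geometry.DiscreteGeometry.hcpKissingPattern)) ∧ dist z y ≤ 10)) → ¬ (∃ a : ℝ, 47 / 50 ≤ a ∧ a ≤ 1 ∧ ∃ t : ℝ, 0 < t ∧ ∃ y ∈ Y, ({w ∈ Y | w ≠ y ∧ dist y w ≤ a * (1 + 1 / 50) - t}.ncard = 12 ∧ (∀ w ∈ Y, w ≠ y → a * (1 - 1 / 50) + t ≤ dist y w ∧ (dist y w ≤ a * (1 + 1 / 50) - t ∨ a * (63 / 50) + t ≤ dist y w)) ∧ (∃ T : Finset (EuclideanSpace ℝ (Fin 3)), (↑T : Set (EuclideanSpace ℝ (Fin 3))) = (fun w => a⁻¹ • (w - y)) '' {w ∈ Y | w ≠ y ∧ dist y w ≤ a * (1 + 1 / 50)} ∧ (Literature.Geometry.DiscreteGeometry.ShellCloseTo (1 / 5 - t) T Literature.Geometry.DiscreteGeometry.fccKissingPattern ∨ Literature.Geometry.DiscreteGeometry.ShellCloseTo (1 / 5 - t) T Literature.Geometry.DiscreteGeometry.hcpKissingPattern))))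 → ∃ W : Literature.MathematicalPhysics.StatisticalMechanics.PeriodicConfiguration 3, ∀ R ε : ℝ, 0 < ε → ∃ᶠ N in Filter.atTop, ∃ t : EuclideanSpace ℝ (Fin 3), (∀ s ∈ W.points, ‖s‖ ≤ R → ∃ i : Fin N, dist (x N i + t) s ≤ ε) ∧ (∀ i : Fin N, ‖x N i + t‖ ≤ R → ∃ s ∈ W.points, dist (x N i + t) s ≤ ε)) :=
  Iff.rfl

/-- PIN · the declared residual at `r₀ = 10`, fully expanded (the text a later bundle registers as `stub_cleanBearingResidual`). -/
theorem cleanBearingResidual_ten_iff : CleanBearingResidual 10 ↔ (∀ e : ℝ, Filter.Tendsto (fun N : ℕ => Literature.MathematicalPhysics.StatisticalMechanics.groundStateEnergy Literature.MathematicalPhysics.StatisticalMechanics.lennardJones 3 N / N) Filter.atTop (nhds e) → (∀ N : ℕ, 0 < N → e ≤ Literature.MathematicalPhysics.StatisticalMechanics.groundStateEnergy Literature.MathematicalPhysics.StatisticalMechanics.lennardJones 3 N / N) → ∀ x : (N : ℕ) → (Fin N → EuclideanSpace ℝ (Fin 3)), (∀ N, Literature.MathematicalPhysics.StatisticalMechanics.IsGroundState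 Literature.MathematicalPhysics.StatisticalMechanics.lennardJones (x N)) → ∀ Y : Set (EuclideanSpace ℝ (Fin 3)), (0 : EuclideanSpace ℝ (Fin 3)) ∈ Y → (∀ R ε : ℝ, 0 < ε → ∃ L : ℝ, ∀ p ∈ Y, ∀ q ∈ Y, ∃ q' ∈ Y, dist q' q ≤ L ∧ (∀ y ∈ Y, dist y p ≤ R → ∃ y' ∈ Y, dist (y' - q') (y - p) ≤ ε) ∧ (∀ y' ∈ Y, dist y' q' ≤ R → ∃ y ∈ Y, dist (y' - q') (y - p) ≤ ε)) → (∃ (φ : ℕ → ℕ) (t : ℕ → EuclideanSpace ℝ (Fin 3)), StrictMono φ ∧ ∀ R ε : ℝ, 0 < ε → ∀ᶠ n in Filter.atTop, (∀ y ∈ Y, ‖y‖ ≤ R → ∃ i : Fin (φ n), dist (x (φ n) i + t n) y ≤ ε) ∧ (∀ i : Fin (φ n), ‖x (φ n) i + t n‖ ≤ R → ∃ y ∈ Y, dist (x (φ n) i + t n) y ≤ ε)) → Literature.MathematicalPhysics.StatisticalMechanics.UniformlyDiscrete Y → Literature.MathematicalPhysics.StatisticalMechanics.IsMuGSC Literature.MathematicalPhysics.StatisticalMechanics.lennardJones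 e Y → (¬ (∃ a : ℝ, 47 / 50 ≤ a ∧ a ≤ 1 ∧ ∀ y ∈ Y, ({w ∈ Y | w ≠ y ∧ dist y w ≤ a * (1 + 1 / 50)}.ncard = 12 ∧ ∀ w ∈ Y, w ≠ y → a * (1 - 1 / 50) ≤ dist y w ∧ (dist y w ≤ a * (1 + 1 / 50) ∨ a * (63 / 50) ≤ dist y w)))) → (∀ z : EuclideanSpace ℝ (Fin 3), ∃ w ∈ Y, dist z w < 9 / 10) → (¬ (∃ W : Literature.MathematicalPhysics.StatisticalMechanics.PeriodicConfiguration 3, W.points = Y)) → (∃ ℓ₀ : ℝ, ∀ ℓ : ℝ, ∀ c : EuclideanSpace ℝ (Fin 3), ℓ₀ ≤ ℓ → ((Y ∩ {z | ∀ i : Fin 3, c i ≤ z i ∧ z i < c i + ℓ}).ncard : ℝ) < 2 * ℓ ^ 3) → (∃ ℓ₀ : ℝ, ∀ ℓ : ℝ, ∀ c : EuclideanSpace ℝ (Fin 3), ℓ₀ ≤ ℓ → 5 / 4 * ℓ ^ 3 < ((Y ∩ {z | ∀ i : Fin 3, c i ≤ z i ∧ z i < c i + ℓ}).ncard : ℝ))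 → (¬ (∃ a : ℝ, 47 / 50 ≤ a ∧ a ≤ 1 ∧ ∃ K : ℝ, 0 < K ∧ ∃ c : EuclideanSpace ℝ (Fin 3), (∃ y ∈ Y, dist y c ≤ K ∧ ¬ (({v ∈ Y | v ≠ y ∧ dist y v ≤ a * (1 + 1 / 10)}.ncard = 12 ∧ ∀ v ∈ Y, v ≠ y → a * (1 - 1 / 10) ≤ dist y v ∧ (dist y v ≤ a * (1 + 1 / 10) ∨ a * (63 / 50) ≤ dist y v)) ∧ (∃ T : Finset (EuclideanSpace ℝ (Fin 3)), (↑T : Set (EuclideanSpace ℝ (Fin 3))) = (fun v => a⁻¹ • (v - y)) '' {v ∈ Y | v ≠ y ∧ dist y v ≤ a * (1 + 1 / 10)} ∧ (Literature.Geometry.DiscreteGeometry.ShellCloseTo (2 / 5) T Literature.Geometry.DiscreteGeometry.fccKissingPattern ∨ Literature.Geometry.DiscreteGeometry.ShellCloseTo (2 / 5) T Literature.Geometry.DiscreteGeometry.hcpKissingPattern)))) ∧ (∀ w ∈ Y, K < dist w c → dist w c ≤ 4 * K + 6 → (({v ∈ Y | v ≠ w ∧ dist w v ≤ a * (1 + 1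 / 50)}.ncard = 12 ∧ ∀ v ∈ Y, v ≠ w → a * (1 - 1 / 50) ≤ dist w v ∧ (dist w v ≤ a * (1 + 1 / 50) ∨ a * (63 / 50) ≤ dist w v)) ∧ (∃ T : Finset (EuclideanSpace ℝ (Fin 3)), (↑T : Set (EuclideanSpace ℝ (Fin 3))) = (fun v => a⁻¹ • (v - w)) '' {v ∈ Y | v ≠ w ∧ dist w v ≤ a * (1 + 1 / 50)} ∧ (Literature.Geometry.DiscreteGeometry.ShellCloseTo (1 / 5) T Literature.Geometry.DiscreteGeometry.fccKissingPattern ∨ Literature.Geometry.DiscreteGeometry.ShellCloseTo (1 / 5) T Literature.Geometry.DiscreteGeometry.hcpKissingPattern)))))) → ((∃ y ∈ Y, (∑' w : ↥Y, Literature.MathematicalPhysics.StatisticalMechanics.lennardJones (dist y (w : EuclideanSpace ℝ (Fin 3)))) < 2 * e) ∧ (∃ y ∈ Y, 2 * e < (∑' w : ↥Y, Literature.MathematicalPhysics.StatisticalMechanics.lennardJones (dist y (w : EuclideanSpace ℝ (Fin 3)))))) → (¬ (∃ κ : ℝ, 0 < κ ∧ (∀ ℓ₀ : ℝ, ∃ ℓ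 : ℝ, ℓ₀ ≤ ℓ ∧ ∃ c : EuclideanSpace ℝ (Fin 3), ∃ F : Finset (EuclideanSpace ℝ (Fin 3)), (↑F : Set (EuclideanSpace ℝ (Fin 3))) = Y ∩ {z | ∀ i : Fin 3, c i ≤ z i ∧ z i < c i + ℓ} ∧ ∃ H : Finset (EuclideanSpace ℝ (Fin 3)), H ⊆ F ∧ 1 / 8 * ((F.card : ℝ) - (H.card : ℝ)) + κ * (F.card : ℝ) ≤ ∑ y ∈ H, ((∑' w : ↥Y, Literature.MathematicalPhysics.StatisticalMechanics.lennardJones (dist y (w : EuclideanSpace ℝ (Fin 3)))) - 2 * e)))) → (∃ L t : ℝ, 0 < t ∧ ∀ q ∈ Y, ∀ a : ℝ, 47 / 50 ≤ a → a ≤ 1 → ∃ y ∈ Y, dist y q ≤ L ∧ ¬ ({w ∈ Y | w ≠ y ∧ dist y w < a * (63 / 50) - t}.ncard ≤ 12 ∧ 12 ≤ {w ∈ Y | w ≠ y ∧ dist y w ≤ a * (1 + 1 / 50) + t}.ncard ∧ ∀ w ∈ Y, w ≠ y → a * (1 - 1 / 50) - t ≤ dist y w ∧ (dist y w ≤ a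 * (1 + 1 / 50) + t ∨ a * (63 / 50) - t ≤ dist y w))) → ¬ (∃ a : ℝ, 47 / 50 ≤ a ∧ a ≤ 1 ∧ (∀ y ∈ Y, ({w ∈ Y | w ≠ y ∧ dist y w ≤ a * (1 + 1 / 50)}.ncard = 12 ∧ ∀ w ∈ Y, w ≠ y → a * (1 - 1 / 50) ≤ dist y w ∧ (dist y w ≤ a * (1 + 1 / 50) ∨ a * (63 / 50) ≤ dist y w)) → (∃ T : Finset (EuclideanSpace ℝ (Fin 3)), (↑T : Set (EuclideanSpace ℝ (Fin 3))) = (fun w => a⁻¹ • (w - y)) '' {w ∈ Y | w ≠ y ∧ dist y w ≤ a * (1 + 1 / 50)} ∧ (Literature.Geometry.DiscreteGeometry.ShellCloseTo (1 / 5) T Literature.Geometry.DiscreteGeometry.fccKissingPattern ∨ Literature.Geometry.DiscreteGeometry.ShellCloseTo (1 / 5) T Literature.Geometry.DiscreteGeometry.hcpKissingPattern))) ∧ (∀ z : EuclideanSpace ℝ (Fin 3), ∃ y ∈ Y, ({w ∈ Y | w ≠ y ∧ dist y w ≤ a * (1 + 1 / 50)}.ncard = 12 ∧ ∀ w ∈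 Y, w ≠ y → a * (1 - 1 / 50) ≤ dist y w ∧ (dist y w ≤ a * (1 + 1 / 50) ∨ a * (63 / 50) ≤ dist y w)) ∧ (∃ T : Finset (EuclideanSpace ℝ (Fin 3)), (↑T : Set (EuclideanSpace ℝ (Fin 3))) = (fun w => a⁻¹ • (w - y)) '' {w ∈ Y | w ≠ y ∧ dist y w ≤ a * (1 + 1 / 50)} ∧ (Literature.Geometry.DiscreteGeometry.ShellCloseTo (1 / 5) T Literature.Geometry.DiscreteGeometry.fccKissingPattern ∨ Literature.Geometry.DiscreteGeometry.ShellCloseTo (1 / 5) T Literature.Geometry.DiscreteGeometry.hcpKissingPattern)) ∧ dist z y ≤ 10)) → (∃ a : ℝ, 47 / 50 ≤ a ∧ a ≤ 1 ∧ ∃ t : ℝ, 0 < t ∧ ∃ y ∈ Y, ({w ∈ Y | w ≠ y ∧ dist y w ≤ a * (1 + 1 / 50) - t}.ncard = 12 ∧ (∀ w ∈ Y, w ≠ y → a * (1 - 1 / 50) + t ≤ dist y w ∧ (dist y w ≤ a * (1 + 1 / 50) - t ∨ a * (63 / 50) + t ≤ dist y w)) ∧ (∃ T : Finset (EuclideanSpace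 ℝ (Fin 3)), (↑T : Set (EuclideanSpace ℝ (Fin 3))) = (fun w => a⁻¹ • (w - y)) '' {w ∈ Y | w ≠ y ∧ dist y w ≤ a * (1 + 1 / 50)} ∧ (Literature.Geometry.DiscreteGeometry.ShellCloseTo (1 / 5 - t) T Literature.Geometry.DiscreteGeometry.fccKissingPattern ∨ Literature.Geometry.DiscreteGeometry.ShellCloseTo (1 / 5 - t) T Literature.Geometry.DiscreteGeometry.hcpKissingPattern)))) → ∃ W : Literature.MathematicalPhysics.StatisticalMechanics.PeriodicConfiguration 3, ∀ R ε : ℝ, 0 < ε → ∃ᶠ N in Filter.atTop, ∃ t : EuclideanSpace ℝ (Fin 3), (∀ s ∈ W.points, ‖s‖ ≤ R → ∃ i : Fin N, dist (x N i + t) s ≤ ε) ∧ (∀ i : Fin N, ‖x N i + t‖ ≤ R → ∃ s ∈ W.points, dist (x N i + t) s ≤ ε)) :=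
  Iff.rfl

/-- PIN · the law, fully expanded over Mathlib + Literature declarations (the text a later bundle registers as `stub_cleanlessExcess`). -/
theorem cleanlessExcess_iff : CleanlessExcess ↔ (∀ e : ℝ, Filter.Tendsto (fun N : ℕ => Literature.MathematicalPhysics.StatisticalMechanics.groundStateEnergy Literature.MathematicalPhysics.StatisticalMechanics.lennardJones 3 N / N) Filter.atTop (nhds e) → (∀ N : ℕ, 0 < N → e ≤ Literature.MathematicalPhysics.StatisticalMechanics.groundStateEnergy Literature.MathematicalPhysics.StatisticalMechanics.lennardJones 3 N / N) → ∀ δ : ℝ, 0 < δ → ∃ κ : ℝ, 0 < κ ∧ ∃ σ : ℝ, 0 ≤ σ ∧ ∀ Y : Set (EuclideanSpace ℝ (Fin 3)), (∀ p ∈ Y, ∀ q ∈ Y, p ≠ q → δ ≤ dist p q) → ∀ c : EuclideanSpace ℝ (Fin 3), ∀ R : ℝ, 1 ≤ R → ∀ K : Set (EuclideanSpace ℝ (Fin 3)), Convex ℝ K → Metric.closedBall c (R / 4) ⊆ K → K ⊆ Metric.closedBall c R → (∀ y ∈ Y ∩ K, ∀ a : ℝ, 47 / 50 ≤ a → a ≤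 1 → ∀ t : ℝ, 0 < t → ¬ ({w ∈ Y | w ≠ y ∧ dist y w ≤ a * (1 + 1 / 50) - t}.ncard = 12 ∧ (∀ w ∈ Y, w ≠ y → a * (1 - 1 / 50) + t ≤ dist y w ∧ (dist y w ≤ a * (1 + 1 / 50) - t ∨ a * (63 / 50) + t ≤ dist y w)) ∧ (∃ T : Finset (EuclideanSpace ℝ (Fin 3)), (↑T : Set (EuclideanSpace ℝ (Fin 3))) = (fun w => a⁻¹ • (w - y)) '' {w ∈ Y | w ≠ y ∧ dist y w ≤ a * (1 + 1 / 50)} ∧ (Literature.Geometry.DiscreteGeometry.ShellCloseTo (1 / 5 - t) T Literature.Geometry.DiscreteGeometry.fccKissingPattern ∨ Literature.Geometry.DiscreteGeometry.ShellCloseTo (1 / 5 - t) T Literature.Geometry.DiscreteGeometry.hcpKissingPattern)))) → ∀ S : Finset (EuclideanSpace ℝ (Fin 3)), (↑S : Set (EuclideanSpace ℝ (Fin 3))) = Y ∩ K → (e + κ) * (S.card : ℝ) - σ * R ^ 2 ≤ 1 / 2 * ∑ y ∈ S, ∑ w ∈ S, Literature.MathematicalPhysics.StatisticalMechanics.lennardJones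 (dist y w)) :=
  Iff.rfl

end Summit.AtomisticToContinuum.Crystallization.Theorems.OverbindingBudgetCleanlessCut
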